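import Mathlib
import Literature.Barriers.RiemannHypothesis.JensenPolynomialsKimProofs
import Literature.Barriers.RiemannHypothesis.JensenPolynomialsChasse
import Literature.NumberTheory.LFunctions.RiemannXiOrderProofs
import Literature.NumberTheory.LFunctions.XiJensenRows
import Mathlib.Analysis.SpecialFunctions.Pow.Real
import Mathlib.Analysis.SpecialFunctions.Log.Monotone
import Literature.NumberTheory.LFunctions.ZetaLogDerivSeries
import Literature.Barriers.RiemannHypothesis.JensenPolynomialsKimCorollary
import Literature.NumberTheory.LFunctions.JensenHyperbolicityRangesRS
import Literature.NumberTheory.LFunctions.EquivalentsJensenProofs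
import Literature.NumberTheory.LFunctions.JensenShiftCertificate
import Literature.NumberTheory.LFunctions.JensenXiFixedDegree
import HarnessLib

/-!
# Effective Kim–Lee for the Jensen polynomials of `ξ`: `J^{d,n}_γ` hyperbolic for `n ≥ 40√d·log(20√d)`; GORTTW 2022 Thm. 1.1 and Kim–Lee 2021 Thm. 1 — `gorttw_thm1_1`, `kimLee_thm1` HOLD (re-homed proofs)

**Effective Kim–Lee for the Jensen polynomials of `ξ`: `J^{d,n}_γ` (`γ = xiTaylorCoeff`, the Taylor data of `ξ(½ + z)`) is
hyperbolic for every `d` and every `n ≥ 40·√d·log(20·√d)`; in particular the two printed open-ended tails hold — Griffin–Ono–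
Rolen–Thorner–Tripp–Wagner, Adv. Math. 397 (2022), Thm. 1.1 (`n > c·e^{d}`, here `c = 800`) [GriffinEtAl2022] and Kim–Lee,
J. Korean Math. Soc. 59 (2022), Thm. 1 (`N(Ξ₀; d) = O(d^{c})`, `c > ½`, here explicit) [KimLee2021]** — via Ki–Kim, Duke Math.
J. 104 (2000) §2 (backward Jensen chains, Gontcharoff) [KiKim2000], Kim–Lee Thm. 2 (ii) made effective (the radius
`(n/log n)²/64` below which `ξ₁⁽ⁿ⁾` has no non-real zero, `n ≥ 2¹⁶`), the Kim–Lee genus-one sector theorem and the tree's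
`d ≤ 10⁶` all-shifts certificate.  The EXACT discharges `Literature.NumberTheory.LFunctions.gorttw_thm1_1_holds` and
`…kimLee_thm1_holds` of the two named facts of `JensenXiFixedDegree.lean`, and `JensenChains.JensenSqrtLogRangeTwenty_holds`
of the range statement `JensenChains.JensenSqrtLogRangeTwenty` (re-homed here as a `def … : Prop` WITH its proof).
RE-HOMED into `Literature/` by the Hodge foundations lane (`lit-hodgefound`, seat p20, generation 37): verbatim DECLARATION-LEVEL
ports (the declarations needed, in dependency order, each with its route-neutralised module docstring) of
`Summits/RiemannHypothesis/RiemannHypothesis/Theorems/JensenPolynomials{EffectiveKimLee, EffectiveKimLeeRadius (7 declarations),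
ChainDefs (4: the `Prop` `JensenSqrtLogRangeTwenty`, the shapes `XiDerivNonrealZeroBeyond`, `JensenWideBandBelow`, the radius
`chainRadius`), SqrtLogRange (10), SqrtLogRangeExplicit (3), PrintedTailsHold}.lean` (cell `rh-jensen`, ladder column JENSEN,
where they are RH-FREE proof-of-data), namespace `Summit.RiemannHypothesis.RiemannHypothesis.Theorems.JensenPolynomials`
re-rooted as `Literature.NumberTheory.LFunctions.JensenChains` (sub-namespaces `EffectiveKimLee`, `KimLee` kept).  Built on the
tree's Literature layer: `Literature/Barriers/RiemannHypothesis/JensenPolynomialsKimProofs.lean` (Kim's theorem, strip case),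
`JensenPolynomialsKimCorollary`, `JensenPolynomialsChasse`, `JensenHyperbolicityRangesRS`, `EquivalentsJensenProofs`,
`Literature/NumberTheory/LFunctions/{RiemannXiOrderProofs, XiJensenRows, JensenShiftCertificate, JensenXiFixedDegree,
ZetaLogDerivSeries}.lean`.

WHAT THIS IS NOT: every statement here is a hyperbolicity RANGE `n ≥ N(d)` with `N(d) → ∞`, inside Farmer's class (Farmer,
Adv. Math. 411 (2022) [Farmer2022]; tree barriers `Literature.Barriers.RiemannHypothesis.JensenPolynomials{,ShiftUniform,Sqrt,Cone}`):
nothing here bears on zeros of `ζ` off the critical line or on the truth of the Riemann Hypothesis.  AI-produced formalisation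
of an effective version that is not in print in this form (the printed Kim–Lee theorem is ineffective; GORTTW's constant is not
computed): the kernel checks the proofs, the statements discharged are the printed ones.  Definitions with bodies, no new
unproved named fact (D-0026); imports Mathlib/Literature only.  The Summits originals stay in place (transitional duplication;
twins = same short names).
-/

noncomputable section

/-!
## Part 1 — port of `Summits/RiemannHypothesis/RiemannHypothesis/Theorems/JensenPolynomialsEffectiveKimLee.lean` (8 declarations kept)

# Effective Kim–Lee for `ξ₁`: an explicit zero-free criterion for the non-real zeros of `ξ₁⁽ⁿ⁾`

`ξ₁ = xiSq` (`ξ(s) = ξ₁((s-½)²)`, tree `riemannXi_eq_xiSq`), real entire of order `< 1`, whose zeros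
`(ρ-½)²` lie in the parabola region `|Im z| ≤ √‖z‖` (tree `exists_zero_of_xiSq_eq_zero`). The tree
proves Kim's theorem for the STRIP case (`Literature/Barriers/RiemannHypothesis/JensenPolynomialsKimProofs.lean`,
Ki–Kim 2000 §2: backward Jensen chain + Gontcharoff's estimate + Cauchy's estimate). This Part
transplants the argument to the PARABOLA case with every constant explicit:

* `im_eq_zero_of_chain_estimate` — **master lemma (general `f`).** Let `f` be real entire of order
  `< 2`, no derivative vanishing identically, with `|Im z| ≤ √‖z‖` at every zero of `f`. Fix
  `u ∈ ℂ`, `n ≥ 1`, `R > 0`, put `s = 1 + √n`, `V̄ = s (s + √R)`,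
  `r̄ = (R + V̄ + ‖u‖) + e² (R + 2V̄ + ‖u‖)`, and let `B` bound `‖f‖` on `‖ζ‖ ≤ r̄`. If
  `B · e^{-2n} < ‖f u‖` then every zero of `f⁽ⁿ⁾` in `‖w‖ < R` is real.
* `norm_xiSq_le_explicit` — `‖ξ₁(z)‖ ≤ 8e⁶ · exp(4(½ + √‖z‖) · log(3/2 + √‖z‖))` (the tree's
  explicit Titchmarsh (2.12.3) on `Re s ≥ ½`, `norm_riemannXi_le_of_half_le_re`, at `s = ½ + √z`).
* `xiSq_one_quarter` — the anchor `ξ₁(¼) = ξ(1) = ½`.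
* `xiSq_derivZeros_real_of_explicit` — **effective Kim–Lee for `ξ₁`, master form:** for `n ≥ 1`,
  `R > 0` and any `r ≥ (R + V̄ + ¼) + e²(R + 2V̄ + ¼)`, if
  `16 e⁶ · exp(4(½ + √r) log(3/2 + √r)) < e^{2n}` then every NON-REAL zero `w` of `ξ₁⁽ⁿ⁾` has
  `R ≤ ‖w‖`.

Under RH every `ξ₁⁽ⁿ⁾` has only real zeros and these statements are vacuous; their content is RH-free complex analysis.
AI-produced formalisation; AI review is weaker than expert review.
References: H. Ki, Y.-O. Kim, Duke Math. J. 104 (2000) §2 (Lemma 2.1, (2.3), (2.5), Thm. 2.1) [KiKim2000];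
Y.-O. Kim, J. Lee, arXiv:2105.05386, Thm. 2 (ii) [KimLee2021]; E. C. Titchmarsh, §2.12 (2.12.3) [Titchmarsh1986].
-/

section Part1

open _root_.Complex _root_.Filter _root_.Metric _root_.Set _root_.Topology
open scoped ComplexConjugate

namespace Literature.NumberTheory.LFunctions.JensenChains.EffectiveKimLee

open Literature.NumberTheory.LFunctions Literature.Analysis.Complex
  Literature.Barriers.RiemannHypothesis

/-! ## Elementary bookkeeping -/

/-- If `0 ≤ s`, `0 ≤ R` and `y² ≤ R + s·y` then `y ≤ s + √R`.
[cite: KimLee2021, Thm. 2 (ii) made effective (Ki–Kim 2000 §2: backward Jensen chains, Gontcharoff and Cauchy estimates; Titchmarsh (2.12.3))] -/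
theorem le_add_sqrt_of_sq_le {y s R : ℝ} (hs : 0 ≤ s) (hR : 0 ≤ R)
    (h : y ^ 2 ≤ R + s * y) : y ≤ s + Real.sqrt R := by
  by_contra hcon
  push Not at hcon
  have hR' : Real.sqrt R ^ 2 = R := Real.sq_sqrt hR
  have hsq : 0 ≤ Real.sqrt R := Real.sqrt_nonneg R
  -- `y - s > √R ≥ 0`, so `(y - s)² > R`, but `(y - s)² ≤ (y - s) y ≤ R`... contradiction
  have h1 : Real.sqrt R < y - s := by linarith
  have h2 : R < (y - s) ^ 2 := by
    calc R = Real.sqrt R ^ 2 := hR'.symm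
      _ < (y - s) ^ 2 := by
          apply pow_lt_pow_left₀ h1 hsq two_ne_zero
  nlinarith

/-! ## The master lemma (general real entire `f` with zeros in the parabola region) -/

/-- **Master lemma (explicit Ki–Kim chain estimate in the parabola case).** Let `f` be entire with
`‖f z‖ ≤ C e^{‖z‖^ρ}` (`0 ≤ ρ < 2`), real on `ℝ`, no derivative vanishing identically, and
`|Im z| ≤ √‖z‖` at every zero of `f`. Let `u ∈ ℂ`, `n ≥ 1`, `R > 0`, `s = 1 + √n`, `V̄ = s(s + √R)`,
`r̄ = (R + V̄ + ‖u‖) + e²(R + 2V̄ + ‖u‖)`, and suppose `‖f ζ‖ ≤ B` for `‖ζ‖ ≤ r̄`. If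
`B · e^{-2n} < ‖f u‖`, then every zero `w` of `f⁽ⁿ⁾` with `‖w‖ < R` is real.
[cite: KimLee2021, Thm. 2 (ii) made effective (Ki–Kim 2000 §2: backward Jensen chains, Gontcharoff and Cauchy estimates; Titchmarsh (2.12.3))] -/
theorem im_eq_zero_of_chain_estimate {f : ℂ → ℂ} (hf : Differentiable ℂ f) {ρ C : ℝ}
    (hρ0 : 0 ≤ ρ) (hρ : ρ < 2) (hgr : ∀ z, ‖f z‖ ≤ C * Real.exp (‖z‖ ^ ρ))
    (hreal : ∀ x : ℝ, (f x).im = 0) (hnz : ∀ k : ℕ, iteratedDeriv k f ≠ 0)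
    (hpar : ∀ z : ℂ, f z = 0 → |z.im| ≤ Real.sqrt ‖z‖)
    (u : ℂ) {n : ℕ} (hn : 1 ≤ n) {R : ℝ} (hR : 0 < R) {B : ℝ}
    (hB : ∀ ζ : ℂ, ‖ζ‖ ≤ (R + (1 + Real.sqrt n) * (1 + Real.sqrt n + Real.sqrt R) + ‖u‖) +
        Real.exp 2 * (R + 2 * ((1 + Real.sqrt n) * (1 + Real.sqrt n + Real.sqrt R)) + ‖u‖) →
      ‖f ζ‖ ≤ B)
    (hlt : B * Real.exp (-2 * (n : ℝ)) < ‖f u‖) :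
    ∀ w : ℂ, iteratedDeriv n f w = 0 → ‖w‖ < R → w.im = 0 := by
  -- abbreviations
  set s : ℝ := 1 + Real.sqrt n with hs
  set Vb : ℝ := s * (s + Real.sqrt R) with hVb
  set ρK : ℝ := R + Vb + ‖u‖ with hρK
  set Λb : ℝ := R + 2 * Vb + ‖u‖ with hΛb
  have hs1 : 1 ≤ s := by have := Real.sqrt_nonneg (n : ℝ); linarith
  have hs0 : 0 ≤ s := by linarith
  have hsqR : 0 ≤ Real.sqrt R := Real.sqrt_nonneg R
  have hVb0 : 0 ≤ Vb := by positivity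
  have hΛpos : 0 < Λb := by positivity
  -- the key step: no zero with `Im w > 0`
  have key : ∀ w : ℂ, 0 < w.im → iteratedDeriv n f w = 0 → ‖w‖ < R → False := by
    intro w hwim hw0 hwR
    obtain ⟨z, hzn, hzero, hpos, hrel⟩ := exists_jensen_chain hf hρ0 hρ hgr hreal hnz n hwim hw0
    -- the variation of the chain
    set V : ℝ := ∑ k ∈ Finset.range n, ‖z k - z (k + 1)‖ with hV
    have hV0 : 0 ≤ V := Finset.sum_nonneg fun k _ ↦ norm_nonneg _
    have hVle : V ≤ (z 0).im * (1 + Real.sqrt n) := chain_variation_le hpos hrel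
    -- all points of the chain are within `V` of `w = z n`
    have hzk : ∀ k ≤ n, ‖z k - z n‖ ≤ V := by
      intro k hk
      have h := dist_le_Ico_sum_dist z hk
      rw [dist_eq_norm] at h
      refine h.trans ?_
      simp only [dist_eq_norm]
      refine Finset.sum_le_sum_of_subset_of_nonneg ?_ fun i _ _ ↦ norm_nonneg _
      rw [Finset.range_eq_Ico]
      exact Finset.Ico_subset_Ico_left (Nat.zero_le _)
    have hznorm : ∀ k ≤ n, ‖z k‖ ≤ R + V := by
      intro k hk
      calc ‖z k‖ = ‖(z k - z n) + z n‖ := by rw [sub_add_cancel]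
        _ ≤ ‖z k - z n‖ + ‖z n‖ := norm_add_le _ _
        _ ≤ V + R := add_le_add (hzk k hk) (by rw [hzn]; exact hwR.le)
        _ = R + V := add_comm _ _
    -- the root zero: `y = Im z₀ ≤ √‖z₀‖ ≤ √(R + V)`, so `y ≤ s + √R` and `V ≤ V̄`
    set y : ℝ := (z 0).im with hy
    have hy0 : 0 < y := hpos 0 (Nat.zero_le _)
    have hfz0 : f (z 0) = 0 := by simpa using hzero 0 (Nat.zero_le _)
    have hy1 : y ≤ Real.sqrt (R + V) := by
      have h1 : |(z 0).im| ≤ Real.sqrt ‖z 0‖ := hpar _ hfz0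
      rw [abs_of_pos hy0] at h1
      exact h1.trans (Real.sqrt_le_sqrt (hznorm 0 (Nat.zero_le _)))
    have hy2 : y ^ 2 ≤ R + s * y := by
      have h1 : y ^ 2 ≤ R + V := by
        calc y ^ 2 ≤ Real.sqrt (R + V) ^ 2 := pow_le_pow_left₀ hy0.le hy1 2
          _ = R + V := Real.sq_sqrt (by linarith)
      have h2 : V ≤ s * y := by rw [hs, mul_comm]; exact hVle
      linarith
    have hy3 : y ≤ s + Real.sqrt R := le_add_sqrt_of_sq_le hs0 hR.le hy2
    have hVVb : V ≤ Vb := by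
      calc V ≤ y * (1 + Real.sqrt n) := hVle
        _ = s * y := by rw [hs, mul_comm]
        _ ≤ s * (s + Real.sqrt R) := mul_le_mul_of_nonneg_left hy3 hs0
    -- the convex set and memberships
    set Kset : Set ℂ := closedBall (0 : ℂ) ρK with hKset
    have hKconv : Convex ℝ Kset := convex_closedBall _ _
    have hmemz : ∀ k ≤ n, z k ∈ Kset := fun k hk ↦ by
      rw [hKset, mem_closedBall_zero_iff]
      have := hznorm k hk
      rw [hρK]; linarith [norm_nonneg u]
    have hmemu : u ∈ Kset := by
      rw [hKset, mem_closedBall_zero_iff, hρK]; linarith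
    -- write `n = j + 1`
    obtain ⟨j, rfl⟩ : ∃ j, n = j + 1 := ⟨n - 1, by omega⟩
    -- Cauchy's estimate on `Kset` with radius `σ = e² Λ̄`
    set σ : ℝ := Real.exp 2 * Λb with hσ
    have hσpos : 0 < σ := by positivity
    have hM : ∀ v ∈ Kset, ‖iteratedDeriv (j + 1) f v‖ ≤ (j + 1).factorial * B / σ ^ (j + 1) := by
      intro v hv
      refine Complex.norm_iteratedDeriv_le_of_forall_mem_sphere_norm_le (j + 1) hσpos
        hf.diffContOnCl fun ζ hζ ↦ hB ζ ?_
      rw [hKset, mem_closedBall_zero_iff] at hv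
      have h1 : ‖ζ - v‖ = σ := mem_sphere_iff_norm.1 hζ
      calc ‖ζ‖ = ‖(ζ - v) + v‖ := by rw [sub_add_cancel]
        _ ≤ ‖ζ - v‖ + ‖v‖ := norm_add_le _ _
        _ ≤ σ + ρK := by rw [h1]; linarith
        _ = ρK + Real.exp 2 * Λb := by rw [hσ]; ring
    -- Gontcharoff
    have hG := gontcharoff_norm_le hKconv j hf z (fun k hk ↦ hmemz k (by omega))
      (fun k hk ↦ hzero k (by omega)) hM hmemu
    -- the variation entering Gontcharoff's estimate is at most `Λ̄`
    have hvar : ‖u - z 0‖ + ∑ k ∈ Finset.range j, ‖z k - z (k + 1)‖ ≤ Λb := by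
      have h1 : ∑ k ∈ Finset.range j, ‖z k - z (k + 1)‖ ≤ V := by
        rw [hV]
        exact Finset.sum_le_sum_of_subset_of_nonneg (Finset.range_subset_range.2 (Nat.le_succ j))
          fun i _ _ ↦ norm_nonneg _
      have h2 : ‖u - z 0‖ ≤ ‖u‖ + (R + V) :=
        (norm_sub_le _ _).trans (add_le_add le_rfl (hznorm 0 (Nat.zero_le _)))
      rw [hΛb]; linarith
    have hvar0 : 0 ≤ ‖u - z 0‖ + ∑ k ∈ Finset.range j, ‖z k - z (k + 1)‖ := by positivity
    -- `B ≥ 0`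
    have hB0 : 0 ≤ B := by
      have h := hB 0 (by simp only [norm_zero]; positivity)
      exact (norm_nonneg _).trans h
    -- combine: `‖f u‖ ≤ B (Λ̄/σ)^{j+1} = B e^{-2(j+1)}`
    have hΛσ : Λb / σ = Real.exp (-2) := by
      rw [hσ, Real.exp_neg]; field_simp
    have hstep : ‖f u‖ ≤ B * Real.exp (-2) ^ (j + 1) := by
      calc ‖f u‖ ≤ (j + 1).factorial * B / σ ^ (j + 1) *
            (‖u - z 0‖ + ∑ k ∈ Finset.range j, ‖z k - z (k + 1)‖) ^ (j + 1) /
              (j + 1).factorial := hG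
        _ ≤ (j + 1).factorial * B / σ ^ (j + 1) * Λb ^ (j + 1) / (j + 1).factorial := by
            gcongr
        _ = B * (Λb / σ) ^ (j + 1) := by
            have hfact : ((j + 1).factorial : ℝ) ≠ 0 := by positivity
            rw [div_pow]
            field_simp
        _ = B * Real.exp (-2) ^ (j + 1) := by rw [hΛσ]
    have hexp : Real.exp (-2) ^ (j + 1) = Real.exp (-2 * ((j + 1 : ℕ) : ℝ)) := by
      rw [← Real.exp_nat_mul]; congr 1; push_cast; ring
    rw [hexp] at hstep
    exact absurd hlt (not_lt.2 hstep)
  -- reduction to `Im w > 0` by reflection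
  intro w hw hwR
  by_contra him
  rcases lt_or_gt_of_ne him with hneg | hpos
  · have hrefl : iteratedDeriv n f (conj w) = conj (iteratedDeriv n f w) :=
      apply_conj_eq_conj (differentiable_iteratedDeriv_of_entire hf n)
        (im_iteratedDeriv_ofReal hf hreal n) w
    refine key (conj w) (by simpa using hneg) (by rw [hrefl, hw, map_zero]) ?_
    simpa using hwR
  · exact key w hpos hw hwR

/-! ## The `ξ₁` data: explicit growth, anchor, parabola -/

/-- **Explicit growth of `ξ₁`:** `‖ξ₁(z)‖ ≤ 8e⁶ · exp(4(½ + √‖z‖) · log(3/2 + √‖z‖))` — the tree's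
explicit Titchmarsh (2.12.3) `‖ξ(s)‖ ≤ 8e⁶ exp(4‖s‖ log(1+‖s‖))` on `Re s ≥ ½`
(`norm_riemannXi_le_of_half_le_re`) at `s = ½ + √z` (principal branch, `Re √z ≥ 0`).
[cite: KimLee2021, Thm. 2 (ii) made effective (Ki–Kim 2000 §2: backward Jensen chains, Gontcharoff and Cauchy estimates; Titchmarsh (2.12.3))] -/
theorem norm_xiSq_le_explicit (z : ℂ) :
    ‖xiSq z‖ ≤ 8 * Real.exp 6 *
      Real.exp (4 * (1 / 2 + Real.sqrt ‖z‖) * Real.log (3 / 2 + Real.sqrt ‖z‖)) := by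
  set w : ℂ := z ^ (2⁻¹ : ℂ) with hw
  have hw2 : w ^ 2 = z := Complex.cpow_nat_inv_pow z two_ne_zero
  have hnw : ‖w‖ = Real.sqrt ‖z‖ := by
    rw [hw, show (2⁻¹ : ℂ) = ((2⁻¹ : ℝ) : ℂ) by push_cast; ring, Complex.norm_cpow_real,
      Real.sqrt_eq_rpow]
    norm_num
  have hre : 1 / 2 ≤ ((1 / 2 : ℂ) + w).re := by
    rw [Complex.add_re, hw, Complex.cpow_inv_two_re]
    have h0 : 0 ≤ Real.sqrt ((‖z‖ + z.re) / 2) := Real.sqrt_nonneg _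
    have h1 : ((1 / 2 : ℂ)).re = 1 / 2 := by norm_num
    rw [h1]; linarith
  rw [xiSq_eq_of_sq_eq hw2]
  refine (norm_riemannXi_le_of_half_le_re hre).trans ?_
  have hn : ‖(1 / 2 : ℂ) + w‖ ≤ 1 / 2 + Real.sqrt ‖z‖ := by
    refine (norm_add_le _ _).trans ?_
    rw [hnw]; norm_num
  have hn0 : 0 ≤ ‖(1 / 2 : ℂ) + w‖ := norm_nonneg _
  have hsq0 : 0 ≤ Real.sqrt ‖z‖ := Real.sqrt_nonneg _
  have hlog0 : 0 ≤ Real.log (1 + ‖(1 / 2 : ℂ) + w‖) := Real.log_nonneg (by linarith)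
  have hlog : Real.log (1 + ‖(1 / 2 : ℂ) + w‖) ≤ Real.log (3 / 2 + Real.sqrt ‖z‖) :=
    Real.log_le_log (by linarith) (by linarith)
  gcongr 8 * Real.exp 6 * Real.exp ?_
  calc 4 * ‖(1 / 2 : ℂ) + w‖ * Real.log (1 + ‖(1 / 2 : ℂ) + w‖)
      ≤ 4 * (1 / 2 + Real.sqrt ‖z‖) * Real.log (1 + ‖(1 / 2 : ℂ) + w‖) := by gcongr
    _ ≤ 4 * (1 / 2 + Real.sqrt ‖z‖) * Real.log (3 / 2 + Real.sqrt ‖z‖) := by gcongr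

/-- **The anchor:** `ξ₁(¼) = ξ(1) = ½` (tree `riemannXi_eq_xiSq`, `riemannXi_one`).
[cite: KimLee2021, Thm. 2 (ii) made effective (Ki–Kim 2000 §2: backward Jensen chains, Gontcharoff and Cauchy estimates; Titchmarsh (2.12.3))] -/
theorem xiSq_one_quarter : xiSq (1 / 4) = 1 / 2 := by
  have h := riemannXi_eq_xiSq 1
  rw [riemannXi_one] at h
  rw [h]; norm_num

/-- The zeros of `ξ₁` lie in the parabola region `|Im z| ≤ √‖z‖`: they are `(ρ-½)²` with
`0 < Re ρ < 1`, so `Im² = 4(Re ρ-½)² (Im ρ)² ≤ (Im ρ)² ≤ ‖z‖` (tree `exists_zero_of_xiSq_eq_zero`).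
[cite: KimLee2021, Thm. 2 (ii) made effective (Ki–Kim 2000 §2: backward Jensen chains, Gontcharoff and Cauchy estimates; Titchmarsh (2.12.3))] -/
theorem abs_im_le_sqrt_norm_of_xiSq_eq_zero {z : ℂ} (hz : xiSq z = 0) :
    |z.im| ≤ Real.sqrt ‖z‖ := by
  obtain ⟨ρ, _hζ, h0, h1, rfl⟩ := exists_zero_of_xiSq_eq_zero hz
  have him : ((ρ - 1 / 2) ^ 2).im = 2 * (ρ.re - 1 / 2) * ρ.im := by
    simp [sq, Complex.mul_im]; ring
  have hnorm : ‖(ρ - 1 / 2) ^ 2‖ = (ρ.re - 1 / 2) ^ 2 + ρ.im ^ 2 := by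
    rw [norm_pow, Complex.sq_norm, Complex.normSq_apply]; simp; ring
  have hx : (ρ.re - 1 / 2) ^ 2 ≤ 1 / 4 := by nlinarith
  have key : ((ρ - 1 / 2) ^ 2).im ^ 2 ≤ ‖(ρ - 1 / 2) ^ 2‖ := by
    rw [him, hnorm]; nlinarith [sq_nonneg ρ.im, sq_nonneg (ρ.re - 1 / 2)]
  calc |((ρ - 1 / 2) ^ 2).im| = Real.sqrt (((ρ - 1 / 2) ^ 2).im ^ 2) :=
        (Real.sqrt_sq_eq_abs _).symm
    _ ≤ Real.sqrt ‖(ρ - 1 / 2) ^ 2‖ := Real.sqrt_le_sqrt key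

/-- `ξ₁` is real on the real axis (from `xiSq_conj`).
[cite: KimLee2021, Thm. 2 (ii) made effective (Ki–Kim 2000 §2: backward Jensen chains, Gontcharoff and Cauchy estimates; Titchmarsh (2.12.3))] -/
theorem im_xiSq_ofReal (x : ℝ) : (xiSq x).im = 0 := by
  have h := xiSq_conj x
  rw [Complex.conj_ofReal] at h
  exact Complex.conj_eq_iff_im.1 h.symm

/-- No derivative of `ξ₁` vanishes identically (`8 ξ₁⁽ᵏ⁾(0) = γ(k) ≠ 0`).
[cite: KimLee2021, Thm. 2 (ii) made effective (Ki–Kim 2000 §2: backward Jensen chains, Gontcharoff and Cauchy estimates; Titchmarsh (2.12.3))] -/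
theorem iteratedDeriv_xiSq_ne_zero (k : ℕ) : iteratedDeriv k xiSq ≠ 0 := by
  intro h
  have := eight_mul_iteratedDeriv_xiSq_zero_ne k
  rw [h] at this
  simp at this

/-! ## Effective Kim–Lee for `ξ₁`, master form -/

/-- **Effective Kim–Lee for `ξ₁` (master form, RH-FREE).** Let `n ≥ 1`, `R > 0`, and let `r` be any
number with `(R + V̄ + ¼) + e²(R + 2V̄ + ¼) ≤ r`, `V̄ = (1 + √n)(1 + √n + √R)`. If
`16 e⁶ · exp(4(½ + √r) log(3/2 + √r)) < e^{2n}`, then every non-real zero `w` of `ξ₁⁽ⁿ⁾` satisfies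
`R ≤ ‖w‖`. (Master lemma `im_eq_zero_of_chain_estimate` for `f = ξ₁` with the anchor `u = ¼`,
`ξ₁(¼) = ½`, the explicit growth `norm_xiSq_le_explicit`, and the parabola
`abs_im_le_sqrt_norm_of_xiSq_eq_zero`.)
[cite: KimLee2021, Thm. 2 (ii) made effective (Ki–Kim 2000 §2: backward Jensen chains, Gontcharoff and Cauchy estimates; Titchmarsh (2.12.3))] -/
theorem xiSq_derivZeros_real_of_explicit {n : ℕ} (hn : 1 ≤ n) {R r : ℝ} (hR : 0 < R)
    (hr : (R + (1 + Real.sqrt n) * (1 + Real.sqrt n + Real.sqrt R) + 1 / 4) +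
        Real.exp 2 * (R + 2 * ((1 + Real.sqrt n) * (1 + Real.sqrt n + Real.sqrt R)) + 1 / 4) ≤ r)
    (hineq : 16 * Real.exp 6 * Real.exp (4 * (1 / 2 + Real.sqrt r) * Real.log (3 / 2 + Real.sqrt r))
        < Real.exp (2 * (n : ℝ))) :
    ∀ w : ℂ, iteratedDeriv n xiSq w = 0 → w.im ≠ 0 → R ≤ ‖w‖ := by
  intro w hw him
  by_contra hlt
  push Not at hlt
  obtain ⟨C, hC⟩ := norm_xiSq_le
  set B : ℝ := 8 * Real.exp 6 * Real.exp (4 * (1 / 2 + Real.sqrt r) *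
    Real.log (3 / 2 + Real.sqrt r)) with hBdef
  have hnorm_u : ‖(1 / 4 : ℂ)‖ = 1 / 4 := by
    rw [show (1 / 4 : ℂ) = ((1 / 4 : ℝ) : ℂ) by push_cast; ring, Complex.norm_real]
    norm_num
  have hB : ∀ ζ : ℂ, ‖ζ‖ ≤ (R + (1 + Real.sqrt n) * (1 + Real.sqrt n + Real.sqrt R) + ‖(1 / 4 : ℂ)‖) +
      Real.exp 2 * (R + 2 * ((1 + Real.sqrt n) * (1 + Real.sqrt n + Real.sqrt R)) + ‖(1 / 4 : ℂ)‖) →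
      ‖xiSq ζ‖ ≤ B := by
    intro ζ hζ
    rw [hnorm_u] at hζ
    have hζ' : ‖ζ‖ ≤ r := hζ.trans hr
    refine (norm_xiSq_le_explicit ζ).trans ?_
    have h1 : Real.sqrt ‖ζ‖ ≤ Real.sqrt r := Real.sqrt_le_sqrt hζ'
    have h0 : 0 ≤ Real.sqrt ‖ζ‖ := Real.sqrt_nonneg _
    have hlog0 : 0 ≤ Real.log (3 / 2 + Real.sqrt ‖ζ‖) := Real.log_nonneg (by linarith)
    rw [hBdef]
    gcongr 8 * Real.exp 6 * Real.exp ?_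
    calc 4 * (1 / 2 + Real.sqrt ‖ζ‖) * Real.log (3 / 2 + Real.sqrt ‖ζ‖)
        ≤ 4 * (1 / 2 + Real.sqrt r) * Real.log (3 / 2 + Real.sqrt ‖ζ‖) := by gcongr
      _ ≤ 4 * (1 / 2 + Real.sqrt r) * Real.log (3 / 2 + Real.sqrt r) := by gcongr
  have hanchor : ‖xiSq (1 / 4 : ℂ)‖ = 1 / 2 := by
    rw [xiSq_one_quarter]
    rw [show (1 / 2 : ℂ) = ((1 / 2 : ℝ) : ℂ) by push_cast; ring, Complex.norm_real]
    norm_num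
  have hlt' : B * Real.exp (-2 * (n : ℝ)) < ‖xiSq (1 / 4 : ℂ)‖ := by
    rw [hanchor]
    have hpos : 0 < Real.exp (2 * (n : ℝ)) := Real.exp_pos _
    have h2 : B * Real.exp (-2 * (n : ℝ)) = (2 * B) / Real.exp (2 * (n : ℝ)) / 2 := by
      rw [show (-2 * (n : ℝ)) = -(2 * (n : ℝ)) by ring, Real.exp_neg]
      field_simp
    rw [h2]
    have h3 : 2 * B < Real.exp (2 * (n : ℝ)) := by
      rw [hBdef]; linarith
    have h4 : 2 * B / Real.exp (2 * (n : ℝ)) < 1 := (div_lt_one hpos).2 h3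
    linarith
  have := im_eq_zero_of_chain_estimate differentiable_xiSq (by norm_num : (0 : ℝ) ≤ 7 / 8)
    (by norm_num : (7 / 8 : ℝ) < 2) hC im_xiSq_ofReal iteratedDeriv_xiSq_ne_zero
    (fun z hz ↦ abs_im_le_sqrt_norm_of_xiSq_eq_zero hz) (1 / 4 : ℂ) hn hR hB hlt' w hw hlt
  exact him this

end Literature.NumberTheory.LFunctions.JensenChains.EffectiveKimLee

end Part1

/-!
## Part 2 — port of `Summits/RiemannHypothesis/RiemannHypothesis/Theorems/JensenPolynomialsEffectiveKimLeeRadius.lean` (7 declarations kept)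

# Effective Kim–Lee for `ξ₁`: the explicit radius `(n / log n)² / 64` for `n ≥ 2¹⁶`

Main result (`xiSq_derivZeros_nonreal_far`): for every `n ≥ 65536 = 2¹⁶` and every zero `w` of `ξ₁⁽ⁿ⁾` with
`Im w ≠ 0`, `(1/64) · (n / log n)² ≤ ‖w‖`.  This is Kim–Lee 2021, Thm. 2 (ii) («the zeros of `Ξ₀⁽ⁿ⁾` in
`Re z < n^{2-ε}`… are real for `n` large», ineffective) made effective with the sharp `log`.

Proof: the master form `EffectiveKimLee.xiSq_derivZeros_real_of_explicit` with `R = q²/64`,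
`q = n / log n`, and the auxiliary radius `r = (q/2 - 3/2)²`; the two hypotheses reduce to
(a) `(1+e²)(R+¼) + (1+2e²)(1+√n)(1+√n+q/8) ≤ (q/2-3/2)²`, which follows from
`√n ≤ (log 2/16)·q` (Mathlib `Real.log_div_sqrt_antitoneOn` on `[2¹⁶, ∞)`) and `q ≥ 5909`, and
(b) `log 16 + 6 + (2q-4)(log q - log 2) < 2n = 2q log n`.  The threshold `2¹⁶` is what these two crude slicings give;
nothing downstream needs a smaller one.  AI-produced formalisation; AI review is weaker than expert review.
References: [KimLee2021, Thm. 2 (ii)]; [KiKim2000, §2].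
-/

section Part2

open _root_.Complex _root_.Filter _root_.Set

namespace Literature.NumberTheory.LFunctions.JensenChains.EffectiveKimLee

open Literature.NumberTheory.LFunctions

/-! ## Numeric constants -/

/-- `e² ≤ 7.3891`.
[cite: KimLee2021, Thm. 2 (ii) (explicit radius (n/log n)²/64 for n ≥ 2¹⁶ below which ξ₁⁽ⁿ⁾ has no non-real zero)] -/
theorem exp_two_le : Real.exp 2 ≤ 7.3891 := by
  have h := Real.exp_one_lt_d9
  have h0 : 0 < Real.exp 1 := Real.exp_pos 1
  have h2 : Real.exp 2 = Real.exp 1 * Real.exp 1 := by rw [← Real.exp_add]; norm_num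
  rw [h2]; nlinarith

/-- `log 65536 = 16 log 2`.
[cite: KimLee2021, Thm. 2 (ii) (explicit radius (n/log n)²/64 for n ≥ 2¹⁶ below which ξ₁⁽ⁿ⁾ has no non-real zero)] -/
theorem log_65536 : Real.log 65536 = 16 * Real.log 2 := by
  rw [show (65536 : ℝ) = 2 ^ 16 by norm_num, Real.log_pow]; norm_num

/-- `√65536 = 256`.
[cite: KimLee2021, Thm. 2 (ii) (explicit radius (n/log n)²/64 for n ≥ 2¹⁶ below which ξ₁⁽ⁿ⁾ has no non-real zero)] -/
theorem sqrt_65536 : Real.sqrt 65536 = 256 := by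
  rw [show (65536 : ℝ) = 256 ^ 2 by norm_num, Real.sqrt_sq (by norm_num)]

/-- `e² ≤ 65536`.
[cite: KimLee2021, Thm. 2 (ii) (explicit radius (n/log n)²/64 for n ≥ 2¹⁶ below which ξ₁⁽ⁿ⁾ has no non-real zero)] -/
theorem exp_two_le_65536 : Real.exp 2 ≤ 65536 := exp_two_le.trans (by norm_num)

/-! ## The slicing lemmas for `x ≥ 2¹⁶`: `L = log x`, `q = x / L` -/

/-- For `x ≥ 65536`: `log x / √x ≤ log 2 / 16` (the function `log x/√x` decreases on `[e², ∞)`).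
[cite: KimLee2021, Thm. 2 (ii) (explicit radius (n/log n)²/64 for n ≥ 2¹⁶ below which ξ₁⁽ⁿ⁾ has no non-real zero)] -/
theorem log_div_sqrt_le {x : ℝ} (hx : 65536 ≤ x) : Real.log x / Real.sqrt x ≤ Real.log 2 / 16 := by
  have h := Real.log_div_sqrt_antitoneOn (a := 65536) (b := x) exp_two_le_65536
    (exp_two_le_65536.trans hx) hx
  simp only at h
  rw [log_65536, sqrt_65536] at h
  linarith

/-- For `x ≥ 65536`: `16 log 2 ≤ log x`, hence `11.09 ≤ log x`.
[cite: KimLee2021, Thm. 2 (ii) (explicit radius (n/log n)²/64 for n ≥ 2¹⁶ below which ξ₁⁽ⁿ⁾ has no non-real zero)] -/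
theorem log_ge {x : ℝ} (hx : 65536 ≤ x) : 11.09 ≤ Real.log x := by
  have h1 : Real.log 65536 ≤ Real.log x := Real.log_le_log (by norm_num) hx
  rw [log_65536] at h1
  have h2 := Real.log_two_gt_d9
  linarith

/-! ## The radius theorem -/

/-- **Effective Kim–Lee for `ξ₁` with the explicit radius (RH-FREE).** For `n ≥ 65536` every zero
`w` of `ξ₁⁽ⁿ⁾` with `Im w ≠ 0` satisfies `(1/64)(n / log n)² ≤ ‖w‖`.
[cite: KimLee2021, Thm. 2 (ii) (explicit radius (n/log n)²/64 for n ≥ 2¹⁶ below which ξ₁⁽ⁿ⁾ has no non-real zero)] -/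
theorem xiSq_derivZeros_nonreal_far (n : ℕ) (hn : 65536 ≤ n) :
    ∀ w : ℂ, iteratedDeriv n xiSq w = 0 → w.im ≠ 0 →
      1 / 64 * ((n : ℝ) / Real.log n) ^ 2 ≤ ‖w‖ := by
  intro w hw him
  -- real bookkeeping: `x = n`, `L = log x ≥ 11.09`, `q = x / L`
  have hx65536 : (65536 : ℝ) ≤ (n : ℝ) := by exact_mod_cast hn
  have hxpos : 0 < (n : ℝ) := by linarith
  have hL11 : 11.09 ≤ Real.log n := log_ge hx65536
  have hLpos : 0 < Real.log n := by linarith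
  set x : ℝ := (n : ℝ) with hx
  set L : ℝ := Real.log x with hL
  set q : ℝ := x / L with hq
  have hqpos : 0 < q := div_pos hxpos hLpos
  have hxqL : x = q * L := by rw [hq]; field_simp
  -- `√x ≤ 0.0433217 q`, `256 ≤ √x`, hence `q ≥ 5909`
  have hl2hi := Real.log_two_lt_d9
  have hl2lo := Real.log_two_gt_d9
  have hsx0 : 0 < Real.sqrt x := Real.sqrt_pos.2 hxpos
  have h256 : 256 ≤ Real.sqrt x := by
    rw [← sqrt_65536]; exact Real.sqrt_le_sqrt hx65536
  have hsxq : Real.sqrt x = q * (L / Real.sqrt x) := by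
    rw [hq, div_mul_div_comm, mul_comm x L, ← div_mul_div_comm, div_self hLpos.ne', one_mul,
      Real.div_sqrt]
  have hε : L / Real.sqrt x ≤ Real.log 2 / 16 := log_div_sqrt_le hx65536
  have hsx : Real.sqrt x ≤ 0.0433217 * q := by
    have h1 : L / Real.sqrt x ≤ 0.0433217 := by linarith
    calc Real.sqrt x = q * (L / Real.sqrt x) := hsxq
      _ ≤ q * 0.0433217 := mul_le_mul_of_nonneg_left h1 hqpos.le
      _ = 0.0433217 * q := mul_comm _ _
  have hq5909 : 5909 ≤ q := by linarith
  have hq2 : (5909 : ℝ) * 5909 ≤ q ^ 2 := by nlinarith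
  -- the two radii `R = (q/8)²` and `r = (q/2 - 3/2)²`
  have hRq : 1 / 64 * q ^ 2 = (q / 8) ^ 2 := by ring
  have hRpos : 0 < 1 / 64 * q ^ 2 := by positivity
  have hsqrtR : Real.sqrt (1 / 64 * q ^ 2) = q / 8 := by rw [hRq, Real.sqrt_sq (by positivity)]
  set t : ℝ := q / 2 - 3 / 2 with ht
  have ht0 : 0 ≤ t := by rw [ht]; linarith
  have hsqrtr : Real.sqrt (t ^ 2) = t := Real.sqrt_sq ht0
  -- (a) the chain radius is at most `r = t²`
  have hs : 1 + Real.sqrt x ≤ 0.0435 * q := by linarith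
  have hs0 : 0 ≤ 1 + Real.sqrt x := by positivity
  set V : ℝ := (1 + Real.sqrt x) * (1 + Real.sqrt x + Real.sqrt (1 / 64 * q ^ 2)) with hV
  have hVb : V ≤ 0.00733 * q ^ 2 := by
    rw [hV, hsqrtR]
    calc (1 + Real.sqrt x) * (1 + Real.sqrt x + q / 8)
        ≤ (0.0435 * q) * (0.0435 * q + q / 8) :=
          mul_le_mul hs (by linarith) (by positivity) (by positivity)
      _ = 0.00732975 * q ^ 2 := by ring
      _ ≤ 0.00733 * q ^ 2 := mul_le_mul_of_nonneg_right (by norm_num) (sq_nonneg q)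
  have hV0 : 0 ≤ V := by rw [hV, hsqrtR]; positivity
  have he2 := exp_two_le
  have hchain : (1 / 64 * q ^ 2 + V + 1 / 4) + Real.exp 2 * (1 / 64 * q ^ 2 + 2 * V + 1 / 4)
      ≤ t ^ 2 := by
    have hpos : 0 ≤ 1 / 64 * q ^ 2 + 2 * V + 1 / 4 := by positivity
    have h1 : (1 / 64 * q ^ 2 + V + 1 / 4) + Real.exp 2 * (1 / 64 * q ^ 2 + 2 * V + 1 / 4) ≤
        (1 / 64 * q ^ 2 + V + 1 / 4) + 7.3891 * (1 / 64 * q ^ 2 + 2 * V + 1 / 4) :=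
      add_le_add le_rfl (mul_le_mul_of_nonneg_right he2 hpos)
    have h2 : (1 / 64 * q ^ 2 + V + 1 / 4) + 7.3891 * (1 / 64 * q ^ 2 + 2 * V + 1 / 4) ≤
        0.2468 * q ^ 2 := by linarith
    have h3 : 0.2468 * q ^ 2 ≤ t ^ 2 := by
      rw [ht]; nlinarith
    linarith
  -- (b) the exponent inequality
  have hineq : 16 * Real.exp 6 *
      Real.exp (4 * (1 / 2 + Real.sqrt (t ^ 2)) * Real.log (3 / 2 + Real.sqrt (t ^ 2)))
      < Real.exp (2 * (n : ℝ)) := by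
    rw [hsqrtr]
    have hq2' : 3 / 2 + t = q / 2 := by rw [ht]; ring
    have hq1 : 1 / 2 + t = q / 2 - 1 := by rw [ht]; ring
    rw [hq2', hq1]
    have hlogq2 : Real.log (q / 2) = Real.log q - Real.log 2 :=
      Real.log_div hqpos.ne' two_ne_zero
    have hlogq : Real.log q = L - Real.log L := by
      rw [hq, Real.log_div hxpos.ne' hLpos.ne']
    have h16 : (16 : ℝ) * Real.exp 6 = Real.exp (4 * Real.log 2 + 6) := by
      rw [Real.exp_add, show (4 : ℝ) * Real.log 2 = Real.log (2 ^ 4) by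
        rw [Real.log_pow]; norm_num, Real.exp_log (by norm_num)]
      norm_num
    rw [h16, ← Real.exp_add, Real.exp_lt_exp, hlogq2, hlogq, show (n : ℝ) = x from rfl, hxqL]
    -- goal: 4 log 2 + 6 + 4 (q/2 - 1) (L - log L - log 2) < 2 (q L)
    have hlogL1 : Real.log L ≤ L - 1 := Real.log_le_sub_one_of_pos hLpos
    have hlogL0 : 0 ≤ Real.log L := Real.log_nonneg (by linarith)
    have hA : 0 ≤ q * Real.log L := mul_nonneg hqpos.le hlogL0
    have hB : (5909 : ℝ) * 0.6931471803 ≤ q * Real.log 2 :=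
      mul_le_mul hq5909 hl2lo.le (by norm_num) hqpos.le
    linarith
  -- conclude by the master form with `R = q²/64`, `r = t²`
  have hn1 : 1 ≤ n := le_trans (by norm_num) hn
  exact xiSq_derivZeros_real_of_explicit hn1 hRpos (r := t ^ 2) hchain hineq w hw him

end Literature.NumberTheory.LFunctions.JensenChains.EffectiveKimLee

end Part2

/-!
## Part 3 — port of `Summits/RiemannHypothesis/RiemannHypothesis/Theorems/JensenPolynomialsChainDefs.lean` (4 declarations kept)

# The √d·log d range and the zero-side vocabulary (typed statements)

Statements about the explicit entire function `G = xiSq` (`G(z) = ξ(½ + √z)`, `Literature.NumberTheory.LFunctions.xiSq`)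
and the explicit real numbers `γ(n) = xiTaylorCoeff n`:

* `JensenSqrtLogRangeTwenty` — `J^{d,n}_γ` is hyperbolic whenever `n ≥ 20 000` and `20·√d·log n ≤ n` (i.e.
  `N(d) ≲ C·√d·log d`; Kim–Lee 2021 Thm. 1 made effective and log-sharp).  A `def … : Prop`, PROVED below
  (`KimLee.jensenSqrtLogRangeTwenty_holds`, exact-name twin in the last Part);
* `XiDerivNonrealZeroBeyond R` — every non-real zero of `G⁽ⁿ⁾` has modulus `≥ R n`; `JensenWideBandBelow R` — the
  hyperbolicity band it yields through the Kim–Lee genus-one sector theorem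
  (`KimLee.splits_jensenPoly_taylor_of_zeros_mem_sector_two`, tree); `chainRadius n = (n / log n)²/64`.

By the tree's barrier entries `Literature.Barriers.RiemannHypothesis.JensenPolynomials{,ShiftUniform,Sqrt,Cone}`
(Farmer 2022) a hyperbolicity RANGE `n ≥ N(d)` with `N(d) → ∞` carries no information about RH.
References: [KiKim2000] H. Ki, Y.-O. Kim, Duke Math. J. 104 (2000) §2; [KimLee2021] Y.-O. Kim, J. Lee,
arXiv:2105.05386 = J. Korean Math. Soc. 59 (2022), Thm. 1, 2(ii), 4; [GORZPNAS2019] Griffin–Ono–Rolen–Zagier,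
PNAS 116 (2019); [Farmer2022] Adv. Math. 411.
-/

section Part3

namespace Literature.NumberTheory.LFunctions.JensenChains

open Literature.NumberTheory.LFunctions _root_.Polynomial _root_.Finset
open scoped _root_.BigOperators _root_.Nat

/-! ## 1. The √d·log d range (statement) -/

/-- **RH-FREE. √d·log d range: `∀ n ≥ 20 000, ∀ d` with `20·√d·log n ≤ n`, `J^{d,n}_γ` is hyperbolic**
(equivalently `400·d ≤ (n / log n)²`; so `N(d) ≤ C·√d·log d`, Kim–Lee 2021 Thm. 1 made effective and
log-sharp for `Ξ₀`). At `n = 40 000` this range reaches `d ≤ (n / (20 log n))² = 35 603`. PROVED below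
(`KimLee.jensenSqrtLogRangeTwenty_holds`).
[cite: KimLee2021, Thm. 1 (the √d·log d range) and Thm. 2 (ii) (zero-free radius shapes); definitions] -/
def JensenSqrtLogRangeTwenty : Prop :=
  ∀ d n : ℕ, 20000 ≤ n → 20 * Real.sqrt d * Real.log n ≤ n → (jensenPoly xiTaylorCoeff d n).Splits

/-! ## 2. Zero-side vocabulary (effective Kim–Lee by Jensen chains) -/

/-- Generic shape: every NON-REAL zero of `G⁽ⁿ⁾ = iteratedDeriv n xiSq` has modulus `≥ R n`. (Under RH it is
vacuous for every `R`: `G⁽ⁿ⁾` is then in the Laguerre–Pólya class; RH-free content depends on `R`.)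
[cite: KimLee2021, Thm. 1 (the √d·log d range) and Thm. 2 (ii) (zero-free radius shapes); definitions] -/
def XiDerivNonrealZeroBeyond (R : ℕ → ℝ) : Prop :=
  ∀ n : ℕ, ∀ z : ℂ, iteratedDeriv n xiSq z = 0 → z.im ≠ 0 → R n ≤ ‖z‖

/-- The WIDE hyperbolicity band below a radius function `R`: `J^{d,n}_γ` hyperbolic whenever
`2d + (1 + √n)·√(2d) ≤ R n`. (`XiDerivNonrealZeroBeyond R → JensenWideBandBelow R` is `KimLee.wideBand_of_beyond` below, from the tree's Jensen
chains and the Kim–Lee genus-one sector theorem.)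
[cite: KimLee2021, Thm. 1 (the √d·log d range) and Thm. 2 (ii) (zero-free radius shapes); definitions] -/
def JensenWideBandBelow (R : ℕ → ℝ) : Prop :=
  ∀ d n : ℕ, 2 * (d : ℝ) + (1 + Real.sqrt n) * Real.sqrt (2 * d) ≤ R n →
    (jensenPoly xiTaylorCoeff d n).Splits

/-- The effective Kim–Lee radius `(n / log n)² / 64`.
[cite: KimLee2021, Thm. 1 (the √d·log d range) and Thm. 2 (ii) (zero-free radius shapes); definitions] -/
def chainRadius (n : ℕ) : ℝ := ((n : ℝ) / Real.log n) ^ 2 / 64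

end Literature.NumberTheory.LFunctions.JensenChains

end Part3

/-!
## Part 4 — port of `Summits/RiemannHypothesis/RiemannHypothesis/Theorems/JensenPolynomialsSqrtLogRange.lean` (10 declarations kept)

# The √d·log d range PROVED: `J^{d,n}_γ` is hyperbolic whenever `n ≥ 20 000` and `20·√d·log n ≤ n`

For the Taylor data `γ = xiTaylorCoeff` of `ξ`: `jensenSqrtLogRangeTwenty_holds : JensenSqrtLogRangeTwenty`, i.e.
`N(d) ≲ C·√d·log d` — Kim–Lee 2021 Thm. 1 (`N(Ξ₀; d) = O(d^{1/2+ε})`, INEFFECTIVE, tree named fact `kimLee_thm1`)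
made EFFECTIVE and log-sharp.  Assembly:

1. `splits_jensenPoly_of_derivZeros_mem_sector` — the SHIFTED sector theorem: if all zeros of `G⁽ⁿ⁾`
   (`G = xiSq`) lie in the double sector `S(δ)` and `d δ² ≤ 1` then `J^{d,n}_γ` is hyperbolic (the
   tree's Kim–Lee genus-one sector theorem `KimLee.splits_jensenPoly_taylor_of_zeros_mem_sector_two`
   applied to `F = G⁽ⁿ⁾`, reindexed by `iteratedDeriv_add_eq`, `re_iteratedDeriv_xiSq`, `jensenPoly_shift`);
2. `abs_im_le_of_iteratedDeriv_xiSq_eq_zero` — every zero `z` of `G⁽ⁿ⁾` has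
   `|Im z| ≤ (1 + √n) + √‖z‖` (backward Jensen chain `exists_jensen_chain`, `chain_variation_le`, root
   zero in the parabola `EffectiveKimLee.abs_im_le_sqrt_norm_of_xiSq_eq_zero`);
3. `wideBand_of_beyond : XiDerivNonrealZeroBeyond R → JensenWideBandBelow R`;
4. the instance `xiDerivNonrealZeroBeyond_chainRadius` (radius `chainRadius n = (n/log n)²/64`
   for `n ≥ 65536`) = `EffectiveKimLee.xiSq_derivZeros_nonreal_far`;
5. the arithmetic `band_arith` : `65536 ≤ n`, `20√d·log n ≤ n ⇒ 2d + (1+√n)√(2d) ≤ chainRadius n`;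
6. the SMALL SHIFTS `20000 ≤ n < 65536`: there `20√d·log n ≤ n` forces `d < 10⁶`, and every such pair `(d, n)` is the
   tree's kernel theorem `jensenPoly_xiTaylorCoeff_splits_allShifts_of_le_1e6'` (`d ≤ 10⁶`, all shifts).

WHAT THIS IS NOT: a hyperbolicity RANGE `n ≥ N(d)` with `N(d) → ∞`; by the tree's barrier entries
`Literature.Barriers.RiemannHypothesis.JensenPolynomials{,ShiftUniform,Sqrt,Cone}` (Farmer 2022) such
a range carries no information about RH.

## References
* [KimLee2021] Y.-O. Kim, J. Lee, *A note on the zeros of Jensen polynomials*, J. Korean Math. Soc.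
  59 (2022) 775–787 = arXiv:2105.05386, Thms. 1, 2, 3, 4.
* [KiKim2000] H. Ki, Y.-O. Kim, Duke Math. J. 104 (2000) 45–73, §2.
* [GORZPNAS2019] Griffin–Ono–Rolen–Zagier, PNAS 116 (2019) 11103–11110.
-/

section Part4

open _root_.Complex _root_.Polynomial
open scoped ComplexConjugate

namespace Literature.NumberTheory.LFunctions.JensenChains.KimLee

open Literature.NumberTheory.LFunctions Literature.Analysis.Complex
  Literature.Analysis.Complex.Obreschkoff Literature.Barriers.RiemannHypothesis
open Literature.NumberTheory.LFunctions.JensenChains.EffectiveKimLee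

/-! ## 1. The shifted sector theorem for `G⁽ⁿ⁾` -/

/-- Real numbers are in every sector of non-negative opening. [cite: KimLee2021, Thms. 1–4 (J^{d,n}_γ hyperbolic for n ≥ 20 000 and 20√d·log n ≤ n: sector theorem + effective zero-free radius + the d ≤ 10⁶ certificate)] -/
theorem mem_sector_of_im_eq_zero {δ : ℝ} (hδ : 0 ≤ δ) {z : ℂ} (hz : z.im = 0) : z ∈ sector δ := by
  rw [mem_sector, hz, abs_zero]; exact mul_nonneg hδ (norm_nonneg z)

/-- No derivative of `G` vanishes at `0`: `Re G⁽ⁿ⁾(0) = γ(n)/8 > 0`. [cite: GORZPNAS2019, §1] -/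
theorem iteratedDeriv_xiSq_zero_ne (n : ℕ) : iteratedDeriv n xiSq 0 ≠ 0 := by
  intro h
  have h1 := re_iteratedDeriv_xiSq n
  rw [h, Complex.zero_re] at h1
  have h2 := xiTaylorCoeff_pos_holds n
  have h3 : xiTaylorCoeff n = 0 := by
    rcases mul_eq_zero.1 h1.symm with h8 | h8
    · norm_num at h8
    · exact h8
  exact h2.ne' h3

/-- **Shifted sector theorem (RH-FREE).** If all zeros of `G⁽ⁿ⁾` lie in the double sector `S(δ)` and
`d δ² ≤ 1`, then `J^{d,n}_γ` is hyperbolic: the tree's Kim–Lee genus-one sector theorem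
`KimLee.splits_jensenPoly_taylor_of_zeros_mem_sector_two` for `F = G⁽ⁿ⁾` (entire of order `< 2` by
`exists_growth_iteratedDeriv`, real by `im_iteratedDeriv_ofReal`, `F 0 ≠ 0`), reindexed:
`J(F; d) = 8⁻¹ · J^{d,n}_γ`. [cite: KimLee2021, Theorem 3] -/
theorem splits_jensenPoly_of_derivZeros_mem_sector (n : ℕ) (δ : ℝ)
    (hzero : ∀ z : ℂ, iteratedDeriv n xiSq z = 0 → z ∈ sector δ) (d : ℕ) (hd : (d : ℝ) * δ ^ 2 ≤ 1) :
    (jensenPoly xiTaylorCoeff d n).Splits := by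
  obtain ⟨C, hC⟩ := norm_xiSq_le
  obtain ⟨ρ', C', hρ'0, hρ', hgr'⟩ :=
    exists_growth_iteratedDeriv differentiable_xiSq (by norm_num : (0 : ℝ) ≤ 7 / 8)
      (by norm_num : (7 / 8 : ℝ) < 2) hC n
  have hF : Differentiable ℂ (iteratedDeriv n xiSq) :=
    differentiable_iteratedDeriv_of_entire differentiable_xiSq n
  have hFreal : ∀ x : ℝ, (iteratedDeriv n xiSq x).im = 0 :=
    im_iteratedDeriv_ofReal differentiable_xiSq im_xiSq_ofReal n
  have h := KimLee.splits_jensenPoly_taylor_of_zeros_mem_sector_two hF hρ'0 hρ' hgr'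
    (apply_conj_eq_conj hF hFreal) (iteratedDeriv_xiSq_zero_ne n) hzero hd
  have hcoef : (fun k => (iteratedDeriv k (iteratedDeriv n xiSq) 0).re) =
      fun k => 8⁻¹ * xiTaylorCoeff (n + k) := by
    funext k
    rw [← iteratedDeriv_add_eq, re_iteratedDeriv_xiSq]
  rw [hcoef, PolyaSchur.jensenPoly_const_mul, ← jensenPoly_shift] at h
  have h8 : jensenPoly xiTaylorCoeff d n =
      Polynomial.C (8 : ℝ) * (Polynomial.C (8⁻¹ : ℝ) * jensenPoly xiTaylorCoeff d n) := by
    rw [← mul_assoc, ← C_mul, mul_inv_cancel₀ (by norm_num : (8 : ℝ) ≠ 0), C_1, one_mul]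
  rw [h8]
  exact h.C_mul 8

/-! ## 2. Every zero of `G⁽ⁿ⁾` is near the real axis: `|Im z| ≤ (1 + √n) + √‖z‖` -/

/-- **RH-FREE:** every zero `z` of `G⁽ⁿ⁾` satisfies `|Im z| ≤ (1 + √n) + √‖z‖` (backward Jensen chain
to a zero `z₀ = (ρ−½)²` of `G`; `Im` decreases along the chain; `Im z₀ ≤ √‖z₀‖`; variation
`≤ Im z₀ (1 + √n)`). [cite: KiKim2000, §2 eq. (2.5)] -/
theorem abs_im_le_of_iteratedDeriv_xiSq_eq_zero (n : ℕ) (w : ℂ) (hw : iteratedDeriv n xiSq w = 0) :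
    |w.im| ≤ (1 + Real.sqrt n) + Real.sqrt ‖w‖ := by
  obtain ⟨C, hC⟩ := norm_xiSq_le
  have h78 : (0 : ℝ) ≤ 7 / 8 := by norm_num
  have h78' : (7 / 8 : ℝ) < 2 := by norm_num
  have key : ∀ u : ℂ, 0 < u.im → iteratedDeriv n xiSq u = 0 →
      u.im ≤ (1 + Real.sqrt n) + Real.sqrt ‖u‖ := by
    intro u hu hfu
    obtain ⟨z, hzn, hzero, hpos, hrel⟩ := exists_jensen_chain differentiable_xiSq h78 h78' hC
      im_xiSq_ofReal iteratedDeriv_xiSq_ne_zero n hu hfu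
    have hV := chain_variation_le hpos hrel
    -- imaginary parts decrease along the chain
    have hmono : ∀ k, k ≤ n → (z k).im ≤ (z 0).im := by
      intro k
      induction k with
      | zero => intro _; exact le_rfl
      | succ k ih =>
        intro hk
        have h1 := hrel k (Nat.lt_of_succ_le hk)
        have h2 := hpos (k + 1) hk
        have h3 := hpos k (Nat.le_of_succ_le hk)
        have h4 : (z (k + 1)).im ≤ (z k).im := by
          nlinarith [sq_nonneg ((z (k + 1)).re - (z k).re)]
        exact h4.trans (ih (Nat.le_of_succ_le hk))
    have himw : u.im ≤ (z 0).im := by rw [← hzn]; exact hmono n le_rfl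
    -- the root zero lies in the parabola: `Im z₀ ≤ √‖z₀‖`
    have hz0 : xiSq (z 0) = 0 := by simpa using hzero 0 (Nat.zero_le _)
    have hroot : (z 0).im ≤ Real.sqrt ‖z 0‖ :=
      (le_abs_self _).trans (abs_im_le_sqrt_norm_of_xiSq_eq_zero hz0)
    -- telescoping: `‖z₀‖ ≤ ‖u‖ + V`
    have htel : ‖z 0‖ ≤ ‖u‖ + ∑ k ∈ Finset.range n, ‖z k - z (k + 1)‖ := by
      have hsum : z 0 - z n = ∑ k ∈ Finset.range n, (z k - z (k + 1)) :=
        (Finset.sum_range_sub' z n).symm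
      have heq : z 0 = z n + (z 0 - z n) := by abel
      calc ‖z 0‖ = ‖z n + (z 0 - z n)‖ := by rw [← heq]
        _ ≤ ‖z n‖ + ‖z 0 - z n‖ := norm_add_le _ _
        _ ≤ ‖u‖ + ∑ k ∈ Finset.range n, ‖z k - z (k + 1)‖ := by
            rw [hsum, hzn]
            linarith [norm_sum_le (Finset.range n) fun k => z k - z (k + 1)]
    -- `t := √‖z₀‖` satisfies `t² ≤ ‖u‖ + t (1 + √n)`, hence `t ≤ (1 + √n) + √‖u‖`
    set t : ℝ := Real.sqrt ‖z 0‖ with ht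
    have ht0 : 0 ≤ t := Real.sqrt_nonneg _
    have ht2 : t ^ 2 = ‖z 0‖ := Real.sq_sqrt (norm_nonneg _)
    have hs1 : (1 : ℝ) ≤ 1 + Real.sqrt n := le_add_of_nonneg_right (Real.sqrt_nonneg _)
    have hs0 : (0 : ℝ) ≤ 1 + Real.sqrt n := zero_le_one.trans hs1
    have hineq : t ^ 2 ≤ ‖u‖ + t * (1 + Real.sqrt n) := by
      rw [ht2]
      calc ‖z 0‖ ≤ ‖u‖ + ∑ k ∈ Finset.range n, ‖z k - z (k + 1)‖ := htel
        _ ≤ ‖u‖ + (z 0).im * (1 + Real.sqrt n) := by linarith [hV]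
        _ ≤ ‖u‖ + t * (1 + Real.sqrt n) := by
            have := mul_le_mul_of_nonneg_right hroot hs0
            linarith
    have hsu : 0 ≤ Real.sqrt ‖u‖ := Real.sqrt_nonneg _
    have hsu2 : Real.sqrt ‖u‖ * Real.sqrt ‖u‖ = ‖u‖ := Real.mul_self_sqrt (norm_nonneg _)
    have htle : t ≤ (1 + Real.sqrt n) + Real.sqrt ‖u‖ := by
      by_contra hlt
      push Not at hlt
      have htpos : 0 < t := by linarith
      have hq : Real.sqrt ‖u‖ ≤ t := by linarith
      have h1 : t * Real.sqrt ‖u‖ < t * (t - (1 + Real.sqrt n)) :=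
        mul_lt_mul_of_pos_left (by linarith) htpos
      have h2 : Real.sqrt ‖u‖ * Real.sqrt ‖u‖ ≤ t * Real.sqrt ‖u‖ :=
        mul_le_mul_of_nonneg_right hq hsu
      nlinarith [h1, h2, hineq, hsu2]
    exact himw.trans (hroot.trans htle)
  rcases lt_trichotomy w.im 0 with hneg | h0 | hpos
  · have hrefl : iteratedDeriv n xiSq (conj w) = conj (iteratedDeriv n xiSq w) :=
      apply_conj_eq_conj (differentiable_iteratedDeriv_of_entire differentiable_xiSq n)
        (im_iteratedDeriv_ofReal differentiable_xiSq im_xiSq_ofReal n) w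
    have h := key (conj w) (by simpa using hneg) (by rw [hrefl, hw, map_zero])
    rw [Complex.conj_im, Complex.norm_conj] at h
    rw [abs_of_neg hneg]; exact h
  · rw [h0, abs_zero]; positivity
  · rw [abs_of_pos hpos]; exact key w hpos hw

/-! ## 3. The wide band from a radius free of non-real zeros -/

/-- **GENERIC GLUE (RH-FREE):** a radius function `R` below which no `G⁽ⁿ⁾` has a NON-REAL zero
ALONE gives the wide band `2d + (1+√n)√(2d) ≤ R n ⇒ J^{d,n}_γ hyperbolic`. For a non-real zero `z`,
`r = ‖z‖ ≥ R n`: `Im² ≤ ((1+√n) + √r)² ≤ 2(1+√n)² + 2r ≤ r²/d` because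
`(r − d)² ≥ (d + (1+√n)√(2d))² ≥ d² + 2d(1+√n)²`, so `z ∈ S(1/√d)`; real zeros are in every sector. [cite: KimLee2021, Theorem 1 (proof)] -/
theorem wideBand_of_beyond {R : ℕ → ℝ} (hR : XiDerivNonrealZeroBeyond R) : JensenWideBandBelow R := by
  intro d n hd
  rcases Nat.eq_zero_or_pos d with rfl | hdpos
  · exact Splits.of_natDegree_eq_zero
      (Nat.le_zero.1 (PolyaSchur.natDegree_jensenPoly_le xiTaylorCoeff 0 n))
  have hd1 : (1 : ℝ) ≤ d := by exact_mod_cast hdpos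
  have hdR : (0 : ℝ) < (d : ℝ) := by linarith
  set δ : ℝ := (Real.sqrt d)⁻¹ with hδdef
  have hsq : 0 < Real.sqrt d := Real.sqrt_pos.2 hdR
  have hδ0 : 0 ≤ δ := by positivity
  set s : ℝ := 1 + Real.sqrt n with hsdef
  have hs0 : 0 ≤ s := by positivity
  have h2d : Real.sqrt (2 * d) ^ 2 = 2 * d := Real.sq_sqrt (by positivity)
  have h2d0 : 0 ≤ Real.sqrt (2 * d) := Real.sqrt_nonneg _
  refine splits_jensenPoly_of_derivZeros_mem_sector n δ ?_ d ?_
  · intro z hz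
    by_cases him : z.im = 0
    · exact mem_sector_of_im_eq_zero hδ0 him
    have hfar : 2 * (d : ℝ) + s * Real.sqrt (2 * d) ≤ ‖z‖ := le_trans hd (hR n z hz him)
    have hnear : |z.im| ≤ s + Real.sqrt ‖z‖ := abs_im_le_of_iteratedDeriv_xiSq_eq_zero n z hz
    have hr0 : 0 ≤ ‖z‖ := norm_nonneg z
    have hsr : Real.sqrt ‖z‖ ^ 2 = ‖z‖ := Real.sq_sqrt hr0
    have hsr0 : 0 ≤ Real.sqrt ‖z‖ := Real.sqrt_nonneg _
    -- Im² ≤ 2 s² + 2 r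
    have hIm2 : z.im ^ 2 ≤ 2 * s ^ 2 + 2 * ‖z‖ := by
      have h1 : z.im ^ 2 = |z.im| ^ 2 := (sq_abs _).symm
      have h2 : |z.im| ^ 2 ≤ (s + Real.sqrt ‖z‖) ^ 2 :=
        pow_le_pow_left₀ (abs_nonneg _) hnear 2
      nlinarith [h1, h2, hsr, sq_nonneg (s - Real.sqrt ‖z‖)]
    -- r² ≥ 2 d r + 2 d s²
    have hkey : z.im ^ 2 * d ≤ ‖z‖ ^ 2 := by
      have h3 : (d : ℝ) + s * Real.sqrt (2 * d) ≤ ‖z‖ - d := by linarith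
      have h4 : ((d : ℝ) + s * Real.sqrt (2 * d)) ^ 2 ≤ (‖z‖ - d) ^ 2 :=
        pow_le_pow_left₀ (by positivity) h3 2
      have h5 : (d : ℝ) ^ 2 + 2 * d * s ^ 2 ≤ ((d : ℝ) + s * Real.sqrt (2 * d)) ^ 2 := by
        nlinarith [h2d, mul_nonneg (mul_nonneg hdR.le hs0) h2d0]
      nlinarith [hIm2, h4, h5, hdR.le]
    rw [mem_sector]
    have hsqd : Real.sqrt d ^ 2 = d := Real.sq_sqrt hdR.le
    have h3 : (|z.im| * Real.sqrt d) ^ 2 ≤ ‖z‖ ^ 2 := by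
      rw [mul_pow, sq_abs, hsqd]; exact hkey
    have h4 : |z.im| * Real.sqrt d ≤ ‖z‖ := by
      have := Real.sqrt_le_sqrt h3
      rwa [Real.sqrt_sq (by positivity), Real.sqrt_sq (norm_nonneg z)] at this
    rw [hδdef]
    rw [← le_div_iff₀ hsq] at h4
    simpa [div_eq_mul_inv, mul_comm] using h4
  · have h1 : (d : ℝ) * δ ^ 2 = 1 := by
      rw [hδdef, inv_pow, Real.sq_sqrt hdR.le, mul_inv_cancel₀ hdR.ne']
    exact h1.le

/-! ## 4. The crux instance and the band arithmetic -/

/-- **The crux in the typed shape (RH-FREE):** no NON-REAL zero of `G⁽ⁿ⁾` below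
`chainRadius n = (n/log n)²/64` for `n ≥ 65536` (no claim below) —
`EffectiveKimLee.xiSq_derivZeros_nonreal_far`. [cite: KimLee2021, Theorem 2] -/
theorem xiDerivNonrealZeroBeyond_chainRadius :
    XiDerivNonrealZeroBeyond (fun n ↦ if 65536 ≤ n then chainRadius n else 0) := by
  intro n z hz him
  dsimp only
  split_ifs with h
  · have h1 := xiSq_derivZeros_nonreal_far n h z hz him
    unfold chainRadius
    linarith
  · exact norm_nonneg z

/-- **Band arithmetic (RH-FREE, elementary):** for `n ≥ 65536` and `20√d·log n ≤ n`,
`2d + (1+√n)√(2d) ≤ (n/log n)²/64`. (With `q = n/log n`: `√d ≤ q/20`, so the left side is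
`≤ q²/200 + 0.0708(1+√n)q`, and `1 + √n ≤ 1.004·0.0434·q` because `log n/√n ≤ log 2/16`.)
[cite: KimLee2021, Thms. 1–4 (J^{d,n}_γ hyperbolic for n ≥ 20 000 and 20√d·log n ≤ n: sector theorem + effective zero-free radius + the d ≤ 10⁶ certificate)] -/
theorem band_arith {d n : ℕ} (hn : 65536 ≤ n) (hdn : 20 * Real.sqrt d * Real.log n ≤ n) :
    2 * (d : ℝ) + (1 + Real.sqrt n) * Real.sqrt (2 * d) ≤ chainRadius n := by
  unfold chainRadius
  have hx : (65536 : ℝ) ≤ n := by exact_mod_cast hn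
  have hn0 : (0 : ℝ) < n := by linarith
  have hL : 11.09 ≤ Real.log (n : ℝ) := log_ge hx
  have hLpos : 0 < Real.log (n : ℝ) := by linarith
  set L : ℝ := Real.log (n : ℝ) with hLdef
  set s : ℝ := Real.sqrt (n : ℝ) with hsdef
  have hs256 : (256 : ℝ) ≤ s := by
    rw [hsdef, ← sqrt_65536]; exact Real.sqrt_le_sqrt hx
  have hs2 : s ^ 2 = n := Real.sq_sqrt hn0.le
  -- `L ≤ 0.0434 s`
  have hLs : L ≤ 0.0434 * s := by
    have h1 := log_div_sqrt_le hx
    have h2 := Real.log_two_lt_d9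
    rw [div_le_iff₀ (by linarith)] at h1
    nlinarith [h1, h2]
  set q : ℝ := (n : ℝ) / L with hqdef
  have hqpos : 0 < q := div_pos hn0 hLpos
  have hqL : q * L = n := by rw [hqdef]; field_simp
  -- `√d ≤ q/20`
  set t : ℝ := Real.sqrt d with htdef
  have ht0 : 0 ≤ t := Real.sqrt_nonneg _
  have ht2 : t ^ 2 = d := Real.sq_sqrt (Nat.cast_nonneg d)
  have htq : t ≤ q / 20 := by
    rw [le_div_iff₀ (by norm_num : (0 : ℝ) < 20), hqdef, le_div_iff₀ hLpos]
    linarith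
  -- `s ≤ 0.0434 q` (from `s² = n = q L ≤ q · 0.0434 s`)
  have hsq : s ≤ 0.0434 * q := by
    have h1 : s * s ≤ (0.0434 * q) * s := by
      calc s * s = q * L := by rw [← sq, hs2, hqL]
        _ ≤ q * (0.0434 * s) := mul_le_mul_of_nonneg_left hLs hqpos.le
        _ = (0.0434 * q) * s := by ring
    exact le_of_mul_le_mul_right h1 (by linarith)
  -- `√(2d) = √2 t ≤ 1.4143 t`
  have h2d : Real.sqrt (2 * (d : ℝ)) ≤ 1.4143 * t := by
    rw [htdef, Real.sqrt_le_iff]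
    refine ⟨by positivity, ?_⟩
    rw [mul_pow, Real.sq_sqrt (Nat.cast_nonneg d)]
    nlinarith
  have h1s : 1 + s ≤ 1.004 * s := by linarith
  -- assemble
  have hA : 2 * (d : ℝ) ≤ q ^ 2 / 200 := by rw [← ht2]; nlinarith [htq, ht0]
  have hB : (1 + s) * Real.sqrt (2 * d) ≤ (1.004 * s) * (1.4143 * (q / 20)) := by
    refine mul_le_mul h1s (h2d.trans ?_) (Real.sqrt_nonneg _) (by positivity)
    nlinarith [htq]
  have hC : (1.004 * s) * (1.4143 * (q / 20)) ≤ 0.0031 * q ^ 2 := by nlinarith [hsq, hqpos]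
  have hgoal : 2 * (d : ℝ) + (1 + s) * Real.sqrt (2 * d) ≤ q ^ 2 / 64 := by
    nlinarith [hA, hB, hC, sq_nonneg q]
  simpa [hqdef] using hgoal

/-! ## 5. The small shifts `n < 65536`: `d < 10⁶`, a tree theorem -/

/-- `9 ≤ log 20000` (`e⁹ < 8104 < 20000`). [cite: KimLee2021, Thms. 1–4 (J^{d,n}_γ hyperbolic for n ≥ 20 000 and 20√d·log n ≤ n: sector theorem + effective zero-free radius + the d ≤ 10⁶ certificate)] -/
theorem nine_le_log_20000 : (9 : ℝ) ≤ Real.log 20000 := by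
  rw [Real.le_log_iff_exp_le (by norm_num)]
  have h1 : Real.exp 1 < 2.7182818286 := Real.exp_one_lt_d9
  have h9 : Real.exp 9 = Real.exp 1 ^ 9 := by rw [← Real.exp_nat_mul]; norm_num
  rw [h9]
  have h2 : Real.exp 1 ^ 9 ≤ (2.7182818286 : ℝ) ^ 9 :=
    pow_le_pow_left₀ (Real.exp_pos 1).le h1.le 9
  have h3 : (2.7182818286 : ℝ) ^ 9 ≤ 20000 := by norm_num
  linarith

/-- **Small shifts (RH-FREE, a tree certificate):** for `20000 ≤ n < 65536` the hypothesis
`20√d·log n ≤ n` forces `√d ≤ 65536/180 < 1000`, hence `d ≤ 10⁶`, and `J^{d,n}_γ` is hyperbolic by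
the tree's `jensenPoly_xiTaylorCoeff_splits_allShifts_of_le_1e6'`. [cite: KimLee2021, Theorem 4] -/
theorem splits_of_small_shift {d n : ℕ} (hn : 20000 ≤ n) (hn' : n < 65536)
    (hdn : 20 * Real.sqrt d * Real.log n ≤ n) : (jensenPoly xiTaylorCoeff d n).Splits := by
  refine jensenPoly_xiTaylorCoeff_splits_allShifts_of_le_1e6' ?_ n
  have hx : (20000 : ℝ) ≤ n := by exact_mod_cast hn
  have hx' : (n : ℝ) < 65536 := by exact_mod_cast hn'
  have hL : 9 ≤ Real.log (n : ℝ) := nine_le_log_20000.trans (Real.log_le_log (by norm_num) hx)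
  have ht0 : 0 ≤ Real.sqrt (d : ℝ) := Real.sqrt_nonneg _
  have ht : Real.sqrt (d : ℝ) ≤ 1000 := by
    by_contra h
    push Not at h
    have : (20 * 1000 * 9 : ℝ) < 20 * Real.sqrt d * Real.log n := by
      have h1 : (20 * 1000 : ℝ) * 9 ≤ 20 * 1000 * Real.log n := by nlinarith
      have h2 : 20 * 1000 * Real.log (n : ℝ) < 20 * Real.sqrt d * Real.log n := by
        have hL0 : 0 < Real.log (n : ℝ) := by linarith
        nlinarith
      linarith
    linarith
  have hd : (d : ℝ) ≤ 1000000 := by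
    have h2 : Real.sqrt (d : ℝ) ^ 2 ≤ 1000 ^ 2 := pow_le_pow_left₀ ht0 ht 2
    rw [Real.sq_sqrt (Nat.cast_nonneg d)] at h2
    linarith
  exact_mod_cast hd

/-! ## 6. The leaf -/

/-- **THE √d·log d RANGE, PROVED (RH-FREE): `JensenSqrtLogRangeTwenty`** — for all `d` and all
`n ≥ 20 000` with `20·√d·log n ≤ n`, the Jensen polynomial `J^{d,n}_γ` of `ξ`'s Taylor data is
hyperbolic (`N(d) ≲ C√d·log d`: Kim–Lee 2021 Thm. 1 made effective). Small shifts by the `d ≤ 10⁶`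
certificate, large shifts by the effective Kim–Lee radius and the wide band.
[cite: KimLee2021, Theorems 1, 2] [cite: KiKim2000, §2] -/
theorem jensenSqrtLogRangeTwenty_holds : JensenSqrtLogRangeTwenty := by
  intro d n hn hdn
  by_cases hsmall : n < 65536
  · exact splits_of_small_shift hn hsmall hdn
  · push Not at hsmall
    have hband := wideBand_of_beyond xiDerivNonrealZeroBeyond_chainRadius d n
    simp only [if_pos hsmall] at hband
    exact hband (band_arith hsmall hdn)

end Literature.NumberTheory.LFunctions.JensenChains.KimLee

end Part4

/-!
## Part 5 — port of `Summits/RiemannHypothesis/RiemannHypothesis/Theorems/JensenPolynomialsSqrtLogRangeExplicit.lean` (3 declarations kept)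

# The EXPLICIT threshold: `J^{d,n}_γ` is hyperbolic for every `d` and every `n ≥ 40·√d·log(20·√d)`

The leaf `JensenSqrtLogRangeTwenty` has its hypothesis implicit in `n`. This Part inverts it into
«`n ≥ C·√d·log d` with explicit `C`»:

* `jensenPoly_xiTaylorCoeff_splits_of_ge` : for ALL `d n : ℕ`, `40·√d·log(20·√d) ≤ n ⇒ J^{d,n}_γ`
  hyperbolic (for `d ≤ 10⁶` every shift is the tree's kernel certificate
  `jensenPoly_xiTaylorCoeff_splits_allShifts_of_le_1e6'`; for `d > 10⁶`, `y = 20√d > 20 000` and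
  `n ≥ 2y·log y` gives `n ≥ 20 000` and, by the antitonicity of `log x / x` on `[e, ∞)`, `y·log n ≤ n`);
* `jensenHyperbolicFrom_xiTaylorCoeff_sqrtLog` : `JensenHyperbolicFrom xiTaylorCoeff d ⌈40·√d·log(20·√d)⌉₊`
  for every `d` — `N(d) ≤ 40√d·log(20√d)`.

A hyperbolicity range `n ≥ N(d)` with `N(d) → ∞` carries no information about RH (Farmer 2022).

## References
* [KimLee2021] Y.-O. Kim, J. Lee, J. Korean Math. Soc. 59 (2022) 775–787 = arXiv:2105.05386, Thm. 1.
* [GORZPNAS2019] Griffin–Ono–Rolen–Zagier, PNAS 116 (2019) 11103–11110, Thm. 1.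
* [GriffinEtAl2022] Griffin–Ono–Rolen–Thorner–Tripp–Wagner, Adv. Math. 397 (2022), Thm. 1.1.
-/

section Part5

open _root_.Polynomial

namespace Literature.NumberTheory.LFunctions.JensenChains.KimLee

open Literature.NumberTheory.LFunctions

/-- The inversion step: for `y ≥ 2` (so that `2y log y ≥ e`) and `n ≥ 2y·log y`, one has `y·log n ≤ n`
(antitonicity of `log x / x` on `[e, ∞)` and `2 log y ≤ y`). [cite: KimLee2021, Theorem 1 (explicit threshold N(d) ≤ 40√d·log(20√d); GORZ 2019 Thm. 1)] -/
theorem mul_log_le_of_ge {y n : ℝ} (hy : 2 ≤ y) (hn : 2 * y * Real.log y ≤ n) : y * Real.log n ≤ n := by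
  have hy0 : 0 < y := by linarith
  have hlogy : Real.log 2 ≤ Real.log y := Real.log_le_log (by norm_num) hy
  have hl2 : 0.6931471803 < Real.log 2 := Real.log_two_gt_d9
  have hlogy0 : 0 < Real.log y := by linarith
  set n₀ : ℝ := 2 * y * Real.log y with hn₀
  have hn₀pos : 0 < n₀ := by positivity
  -- `e ≤ n₀`: `n₀ ≥ 4 log 2 > 2.77 > e`
  have he : Real.exp 1 ≤ n₀ := by
    have h1 : Real.exp 1 < 2.7182818286 := Real.exp_one_lt_d9
    have h2 : 4 * Real.log 2 ≤ n₀ := by rw [hn₀]; nlinarith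
    linarith
  have hn0 : 0 < n := lt_of_lt_of_le hn₀pos hn
  -- antitone: `log n / n ≤ log n₀ / n₀`
  have hanti := Real.log_div_self_antitoneOn (Set.mem_Ici.2 he) (Set.mem_Ici.2 (he.trans hn)) hn
  simp only at hanti
  -- `log n₀ ≤ 2 log y` since `n₀ ≤ y²` (`2 log y ≤ y`, from `log(y/2) ≤ y/2 − 1`, `log 2 < 1`;
  -- cf. `Literature.NumberTheory.LFunctions.LittlewoodRH.two_mul_log_le`)
  have h2log : 2 * Real.log y ≤ y := by
    have h1 : Real.log (y / 2) ≤ y / 2 - 1 := Real.log_le_sub_one_of_pos (by positivity)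
    have h2 : Real.log (y / 2) = Real.log y - Real.log 2 := by
      rw [Real.log_div hy0.ne' (by norm_num)]
    have h3 : Real.log 2 < 1 := by
      have := Real.log_two_lt_d9; linarith
    linarith
  have hn₀y : n₀ ≤ y ^ 2 := by
    rw [hn₀]; nlinarith [h2log]
  have hlogn₀ : Real.log n₀ ≤ 2 * Real.log y := by
    have h2 : Real.log (y ^ 2) = 2 * Real.log y := by
      rw [Real.log_pow]; norm_num
    rw [← h2]
    exact Real.log_le_log hn₀pos hn₀y
  -- `y log n₀ ≤ n₀`
  have hkey : y * Real.log n₀ ≤ n₀ := by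
    calc y * Real.log n₀ ≤ y * (2 * Real.log y) := mul_le_mul_of_nonneg_left hlogn₀ hy0.le
      _ = n₀ := by rw [hn₀]; ring
  -- conclude: `y log n = y n (log n / n) ≤ y n (log n₀ / n₀) ≤ n`
  have h1 : Real.log n ≤ n * (Real.log n₀ / n₀) := by
    have := mul_le_mul_of_nonneg_left hanti hn0.le
    rwa [mul_div_cancel₀ _ hn0.ne'] at this
  calc y * Real.log n ≤ y * (n * (Real.log n₀ / n₀)) := mul_le_mul_of_nonneg_left h1 hy0.le
    _ = n * (y * Real.log n₀ / n₀) := by ring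
    _ ≤ n * 1 := by
        apply mul_le_mul_of_nonneg_left _ hn0.le
        rw [div_le_one hn₀pos]; exact hkey
    _ = n := mul_one n

/-- **EXPLICIT √d·log d RANGE (RH-FREE): for all `d, n` with `40·√d·log(20·√d) ≤ n`, `J^{d,n}_γ` is
hyperbolic** — the effective Kim–Lee threshold `N(d) ≤ 40√d·log(20√d) = 20√d·log d + 119.8…·√d`.
Degrees `d ≤ 10⁶`: every shift, by the tree's certificate; `d > 10⁶`: the leaf
`JensenSqrtLogRangeTwenty` with `y = 20√d ≥ 20 000`, `n ≥ 2y log y ⇒ n ≥ 20 000 ∧ y log n ≤ n`.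
[cite: KimLee2021, Theorem 1] -/
theorem jensenPoly_xiTaylorCoeff_splits_of_ge (d n : ℕ)
    (hn : 40 * Real.sqrt d * Real.log (20 * Real.sqrt d) ≤ n) :
    (jensenPoly xiTaylorCoeff d n).Splits := by
  by_cases hd : d ≤ 1000000
  · exact jensenPoly_xiTaylorCoeff_splits_allShifts_of_le_1e6' hd n
  · push Not at hd
    have hd' : (1000000 : ℝ) ≤ d := by exact_mod_cast hd.le
    have hsd : (1000 : ℝ) ≤ Real.sqrt d := by
      rw [show (1000 : ℝ) = Real.sqrt (1000 ^ 2) by rw [Real.sqrt_sq (by norm_num)]]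
      exact Real.sqrt_le_sqrt (by linarith)
    set y : ℝ := 20 * Real.sqrt d with hy
    have hy2 : (20000 : ℝ) ≤ y := by rw [hy]; linarith
    have hn' : 2 * y * Real.log y ≤ n := by rw [hy]; linarith
    -- `n ≥ 20000`: `2 y log y ≥ 2 · 20000 · 9`
    have hlogy : 9 ≤ Real.log y := nine_le_log_20000.trans (Real.log_le_log (by norm_num) hy2)
    have hn20000 : (20000 : ℝ) ≤ n := by nlinarith
    have hnN : 20000 ≤ n := by exact_mod_cast hn20000
    refine jensenSqrtLogRangeTwenty_holds d n hnN ?_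
    have := mul_log_le_of_ge (by linarith : (2 : ℝ) ≤ y) hn'
    rw [hy] at this
    linarith

/-- **The column's `N(d)`, explicit (RH-FREE):** `JensenHyperbolicFrom xiTaylorCoeff d ⌈40√d·log(20√d)⌉₊`
for every degree `d` — all Jensen polynomials `J^{d,n}_γ` with `n ≥ ⌈40√d·log(20√d)⌉` are hyperbolic
(GORZ 2019 Thm. 1: `∃ N(d)`; GORTTW 2022: `N(d) ≤ c·e^{d}`; Kim–Lee 2021:
`O(d^{1/2+ε})` ineffective; here `N(d) = O(√d log d)` explicit).
[cite: KimLee2021, Theorem 1] [cite: GORZPNAS2019, Thm. 1] -/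
theorem jensenHyperbolicFrom_xiTaylorCoeff_sqrtLog (d : ℕ) :
    JensenHyperbolicFrom xiTaylorCoeff d ⌈40 * Real.sqrt d * Real.log (20 * Real.sqrt d)⌉₊ := by
  intro n hn
  refine jensenPoly_xiTaylorCoeff_splits_of_ge d n ?_
  have h1 := Nat.le_ceil (40 * Real.sqrt d * Real.log (20 * Real.sqrt d))
  have h2 : ((⌈40 * Real.sqrt d * Real.log (20 * Real.sqrt d)⌉₊ : ℕ) : ℝ) ≤ n := by exact_mod_cast hn
  linarith

end Literature.NumberTheory.LFunctions.JensenChains.KimLee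

end Part5

/-!
## Part 6 — port of `Summits/RiemannHypothesis/RiemannHypothesis/Theorems/JensenPolynomialsPrintedTailsHold.lean` (4 declarations kept)

# The two PRINTED open-ended tails as theorems: GORTTW 2022 Thm. 1.1 (`n > c·e^{d}`) and Kim–Lee 2021
# Thm. 1 (`N(Ξ₀; d) = O(d^{c})`, `c > ½`)

`Literature/NumberTheory/LFunctions/JensenXiFixedDegree.lean` types, AS PRINTED and as NAMED FACTS,
`gorttw_thm1_1 : ∃ c > 0, ∀ d n, 1 ≤ d → c·e^{d} < n → J^{d,n}_γ hyperbolic` [GriffinEtAl2022, Thm. 1.1; the constant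
`c` is absolute and uncomputed in print] and `kimLee_thm1 : ∀ c > ½, ∃ C d₀, ∀ d ≥ d₀, ∃ N ≤ C·d^{c}, JensenHyperbolicFrom
xiTaylorCoeff d N` [KimLee2021, Thm. 1; INEFFECTIVE in print].  Both follow from the explicit threshold
`N(d) ≤ 40√d·log(20√d)` (previous Part):

* `gorttw_thm1_1_holds : gorttw_thm1_1` with the EXPLICIT constant `c = 800` (`40√d·log(20√d) ≤ 800d ≤ 800e^{d}`);
* `kimLee_thm1_holds : kimLee_thm1` with the EXPLICIT `C = 40·20^{2c−1}/(2c−1) + 1`, `d₀ = 1`,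
  `N = ⌈40√d·log(20√d)⌉₊` (`log x ≤ x^{η}/η`, `η = 2c − 1`, Mathlib `Real.log_le_rpow_div`).

The EXACT-name discharges in `Literature.NumberTheory.LFunctions` are the last Part.  WHAT THIS IS NOT: every statement
here is a hyperbolicity RANGE with `N(d) → ∞`, inside Farmer's class: nothing here bears on zeros of `ζ` off the critical
line or on the truth of RH.

## References
* [GriffinEtAl2022] Griffin–Ono–Rolen–Thorner–Tripp–Wagner, Adv. Math. 397 (2022) 108186, Thm. 1.1.
* [KimLee2021] Y.-O. Kim, J. Lee, J. Korean Math. Soc. 59 (2022) 775–787 = arXiv:2105.05386, Thm. 1.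
-/

section Part6

open _root_.Polynomial

namespace Literature.NumberTheory.LFunctions.JensenChains.KimLee

open Literature.NumberTheory.LFunctions

/-- For `d ≥ 1`: `40√d·log(20√d) ≤ 800·d`. [cite: GriffinEtAl2022, Theorem 1.1 (n > c·e^d, here c = 800) and KimLee2021 Theorem 1 (N(Ξ₀; d) = O(d^c), c > ½, here explicit)] -/
theorem threshold_le_800_mul {d : ℕ} (hd : 1 ≤ d) :
    40 * Real.sqrt d * Real.log (20 * Real.sqrt d) ≤ 800 * d := by
  have hd0 : (0 : ℝ) < d := by exact_mod_cast hd
  have hs : 0 < Real.sqrt d := Real.sqrt_pos.2 hd0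
  have hs2 : Real.sqrt d ^ 2 = d := Real.sq_sqrt hd0.le
  have hlog : Real.log (20 * Real.sqrt d) ≤ 20 * Real.sqrt d := by
    have := Real.log_le_sub_one_of_pos (by positivity : 0 < 20 * Real.sqrt d); linarith
  calc 40 * Real.sqrt d * Real.log (20 * Real.sqrt d)
      ≤ 40 * Real.sqrt d * (20 * Real.sqrt d) := mul_le_mul_of_nonneg_left hlog (by positivity)
    _ = 800 * Real.sqrt d ^ 2 := by ring
    _ = 800 * d := by rw [hs2]

/-- **GORTTW 2022, Thm. 1.1 — DISCHARGED with the explicit constant `c = 800` (RH-FREE):** there is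
`c > 0` (namely `800`) such that for all `d ≥ 1` and `n > c·e^{d}`, `J^{d,n}_γ` is hyperbolic.
(From `N(d) ≤ 40√d·log(20√d) ≤ 800d ≤ 800e^{d}`.) [cite: GriffinEtAl2022, Theorem 1.1] -/
theorem gorttw_thm1_1_holds : gorttw_thm1_1 := by
  refine ⟨800, by norm_num, fun d n hd hn ↦ ?_⟩
  refine jensenPoly_xiTaylorCoeff_splits_of_ge d n ?_
  have h1 := threshold_le_800_mul hd
  have h2 : (d : ℝ) ≤ Real.exp d := by
    have := Real.add_one_le_exp (d : ℝ); linarith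
  nlinarith

/-- For `d ≥ 1` and `η > 0`: `40√d·log(20√d) ≤ (40·20^{η}/η)·d^{(1+η)/2}` (`log x ≤ x^{η}/η`).
[cite: GriffinEtAl2022, Theorem 1.1 (n > c·e^d, here c = 800) and KimLee2021 Theorem 1 (N(Ξ₀; d) = O(d^c), c > ½, here explicit)] -/
theorem threshold_le_rpow {d : ℕ} (hd : 1 ≤ d) {η : ℝ} (hη : 0 < η) :
    40 * Real.sqrt d * Real.log (20 * Real.sqrt d) ≤
      40 * (20 : ℝ) ^ η / η * (d : ℝ) ^ ((1 + η) / 2) := by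
  have hd0 : (0 : ℝ) < d := by exact_mod_cast hd
  set s : ℝ := Real.sqrt d with hsdef
  have hs : 0 < s := Real.sqrt_pos.2 hd0
  have hlog : Real.log (20 * s) ≤ (20 * s) ^ η / η :=
    Real.log_le_rpow_div (by positivity) hη
  have hmul : (20 * s) ^ η = (20 : ℝ) ^ η * s ^ η := Real.mul_rpow (by norm_num) hs.le
  -- `s · s^η = s^{1+η} = d^{(1+η)/2}`
  have hpow : s * s ^ η = (d : ℝ) ^ ((1 + η) / 2) := by
    have h1 : s * s ^ η = s ^ (1 + η) := by
      rw [Real.rpow_add hs, Real.rpow_one]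
    have h2 : s = (d : ℝ) ^ (1 / 2 : ℝ) := by rw [hsdef, Real.sqrt_eq_rpow]
    rw [h1, h2, ← Real.rpow_mul hd0.le]
    congr 1; ring
  calc 40 * s * Real.log (20 * s) ≤ 40 * s * ((20 * s) ^ η / η) :=
        mul_le_mul_of_nonneg_left hlog (by positivity)
    _ = 40 * (20 : ℝ) ^ η / η * (s * s ^ η) := by rw [hmul]; ring
    _ = 40 * (20 : ℝ) ^ η / η * (d : ℝ) ^ ((1 + η) / 2) := by rw [hpow]

/-- **Kim–Lee 2021, Thm. 1 for `Ξ₀` — DISCHARGED and made EFFECTIVE (RH-FREE):** for every `c > ½`,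
with `C = 40·20^{2c−1}/(2c−1) + 1` and `d₀ = 1`, every degree `d ≥ 1` has a shift threshold
`N = ⌈40√d·log(20√d)⌉₊ ≤ C·d^{c}` with `J^{d,n}_γ` hyperbolic for all `n ≥ N` (in print:
`N(Ξ₀; d) = O(d^{c})`, ineffective). [cite: KimLee2021, Theorem 1] -/
theorem kimLee_thm1_holds : kimLee_thm1 := by
  intro c hc
  set η : ℝ := 2 * c - 1 with hη
  have hη0 : 0 < η := by rw [hη]; linarith
  refine ⟨40 * (20 : ℝ) ^ η / η + 1, 1, fun d hd ↦ ?_⟩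
  refine ⟨⌈40 * Real.sqrt d * Real.log (20 * Real.sqrt d)⌉₊, ?_,
    jensenHyperbolicFrom_xiTaylorCoeff_sqrtLog d⟩
  have hd1 : (1 : ℝ) ≤ d := by exact_mod_cast hd
  have hd0 : (0 : ℝ) < d := by linarith
  have hs1 : 1 ≤ Real.sqrt d := by rw [← Real.sqrt_one]; exact Real.sqrt_le_sqrt hd1
  -- the threshold is nonnegative
  have hx0 : 0 ≤ 40 * Real.sqrt d * Real.log (20 * Real.sqrt d) := by
    have : 0 ≤ Real.log (20 * Real.sqrt d) := Real.log_nonneg (by linarith)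
    positivity
  have hceil : ((⌈40 * Real.sqrt d * Real.log (20 * Real.sqrt d)⌉₊ : ℕ) : ℝ) <
      40 * Real.sqrt d * Real.log (20 * Real.sqrt d) + 1 := Nat.ceil_lt_add_one hx0
  have hmain := threshold_le_rpow hd hη0
  have hexp : (1 + η) / 2 = c := by rw [hη]; ring
  rw [hexp] at hmain
  have hone : (1 : ℝ) ≤ (d : ℝ) ^ c := Real.one_le_rpow hd1 (by linarith)
  have hK : 0 ≤ 40 * (20 : ℝ) ^ η / η := by positivity
  calc ((⌈40 * Real.sqrt d * Real.log (20 * Real.sqrt d)⌉₊ : ℕ) : ℝ)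
      ≤ 40 * Real.sqrt d * Real.log (20 * Real.sqrt d) + 1 := hceil.le
    _ ≤ 40 * (20 : ℝ) ^ η / η * (d : ℝ) ^ c + 1 * (d : ℝ) ^ c := by linarith [hmain, hone]
    _ = (40 * (20 : ℝ) ^ η / η + 1) * (d : ℝ) ^ c := by ring

end Literature.NumberTheory.LFunctions.JensenChains.KimLee

end Part6

/-! ## Part 7 — the EXACT discharges -/

namespace Literature.NumberTheory.LFunctions

/-- **The named fact `JensenChains.JensenSqrtLogRangeTwenty` HOLDS** (the √d·log d range; exact-name twin of
`JensenChains.KimLee.jensenSqrtLogRangeTwenty_holds`, Part 4). [cite: KimLee2021, Theorem 1] -/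
theorem JensenChains.JensenSqrtLogRangeTwenty_holds : JensenChains.JensenSqrtLogRangeTwenty :=
  JensenChains.KimLee.jensenSqrtLogRangeTwenty_holds

/-- **The named fact `gorttw_thm1_1` HOLDS** (`JensenXiFixedDegree.lean`; Griffin–Ono–Rolen–Thorner–Tripp–Wagner, Adv. Math.
397 (2022), Thm. 1.1: there is `c > 0` such that `J^{d,n}_γ` is hyperbolic for `n > c·e^{d}`; here `c = 800`).  EXACT-name
restatement of `JensenChains.KimLee.gorttw_thm1_1_holds` (Part 6), Literature-side twin of
`Summit.RiemannHypothesis.RiemannHypothesis.Theorems.JensenPolynomials.KimLee.gorttw_thm1_1_holds` (same proof).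
[cite: GriffinEtAl2022, Theorem 1.1] -/
theorem gorttw_thm1_1_holds : gorttw_thm1_1 := JensenChains.KimLee.gorttw_thm1_1_holds

/-- **The named fact `kimLee_thm1` HOLDS** (`JensenXiFixedDegree.lean`; Kim–Lee, J. Korean Math. Soc. 59 (2022), Thm. 1:
`N(Ξ₀; d) = O(d^{c})` for every `c > ½`; here with explicit constants).  EXACT-name restatement of
`JensenChains.KimLee.kimLee_thm1_holds` (Part 6). [cite: KimLee2021, Theorem 1] -/
theorem kimLee_thm1_holds : kimLee_thm1 := JensenChains.KimLee.kimLee_thm1_holds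

end Literature.NumberTheory.LFunctions

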